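import Mathlib
import Literature.Analysis.Convex.RestartedPDHG
import Literature.Analysis.Convex.HoffmanErrorBound
import HarnessLib

/-!
# Linear programs (and unconstrained bilinear saddles) are sharp (Applegate–Hinder–Lu–Lubin,
# *Math. Program.* 201 (2023), §3.2–§3.3, Lemmas 3–5, via Hoffman's bound), and restarted PDHG —
# fixed-frequency or adaptive — converges linearly on LP

Sources.
* [ApplegateEtAl2022] D. Applegate, O. Hinder, H. Lu, M. Lubin, *Faster first-order primal-dual
  methods for linear programming using restarts and sharpness*, Math. Program. 201 (2023) 133–184
  (arXiv:2105.12715): §3 Definition 1 (sharp primal–dual problem on a set `S`: `α dist(z, Z*) ≤ ρ_r(z)`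
  for `z ∈ S`, `r ∈ (0, diam S]`), the remark of §3 (p. 10) that "for any other norms, the sharpness
  condition still holds (up to a constant)", §3.3 (20)–(22) (LP, its dual, the Lagrangian on `x ≥ 0`),
  §3.2 Lemma 2 (`dist(S, z) ≤ ‖Hz − h‖/σ_min⁺(H)`) and **Lemma 3** (bilinear problems are
  `σ_min⁺(A)`-sharp on all of `Z`: `ρ_r(z) = ‖F(z)‖`, `Z* = {Hz = h}`), the KKT system `Kz ≥ h` of
  §3.3, **Lemma 4** (the KKT residual `‖(h − Kz)⁺‖` is bounded by
  `√(1+R²) ρ_r(z)`: two test points, (eq:lp-1) along the infeasibility vector and (eq:lp-2)–(eq:lp-3)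
  shrinking `z` towards `0`), (23) (Hoffman constant `dist(z, Z*) ≤ H(K) ‖(h − Kz)⁺‖`) and
  **Lemma 5** (LP is `α`-sharp on `W_R(0)`, `α = 1/(H(K)√(1+4R²))`); §4 Theorem 1 (restarts ⇒
  linear convergence under sharpness; in the tree: `RestartedPDHG.infDistM_iterate_avgPDHG_le_pow`),
  Theorem 2 (adaptive restarts; `RestartedPDHG.infDistM_adaptive_avgPDHG_le`) and Proposition 9
  (restart points of restarted PDHG stay in `W_R(z^{0,0})`; `RestartedPDHG.restart_mem_ballM`).
* [Hoffman1952] A. J. Hoffman, *On approximate solutions of systems of linear inequalities*,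
  J. Research Nat. Bur. Standards 49 (1952) 263–265, Theorem (§2) — in the tree:
  `HoffmanErrorBound.hoffman` (with the `ℓ¹` residual `Σ_i (⟨a_i, x⟩ − b_i)₊`).

Contents (all theorems proved; no named facts).
* The LP saddle in the tree's vocabulary: `conicL K c b x y = ⟨c, x⟩ + ⟨Kx, y⟩ − ⟨b, y⟩` on
  `orthant ιx × univ`, i.e. the primal `min ⟨c, x⟩ s.t. Kx = b, x ≥ 0` and the dual
  `max ⟨b, λ⟩ s.t. K*λ ≤ c` (`y = −λ`); `mem_saddleSet_lp_iff` = the KKT description of the saddle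
  set `Z*` (primal feasibility, dual feasibility `c + K*y ≥ 0`, zero duality gap `⟨c, x⟩ + ⟨b, y⟩ ≤ 0`),
  and `kktNormal`/`kktRhs`/`mem_polyhedron_kkt_iff`/`polyhedron_kkt_eq`: `Z*` is the polyhedron
  `{⟨a_ρ, ·⟩ ≤ h_ρ}` of [ApplegateEtAl2022, §3.3 (K, h)] inside `WithLp 2 (X × Y)`.
* Norm comparison between the PDHG seminorm `‖·‖_M` ([ApplegateEtAl2022, Prop. 1],
  `RestartedPDHG.normM`) and the Euclidean norm of `X × Y`: `normM_le_cUp_mul`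
  (`‖d‖_M ≤ c↑ ‖d‖₂`, `c↑ = √(τ⁻¹ + σ⁻¹ + ‖K‖)`), `cLow_mul_le_normM` (`c↓ ‖d‖₂ ≤ ‖d‖_M`,
  `c↓ = √((1 − √(τσ)‖K‖) min(τ⁻¹, σ⁻¹))`, positive iff `τσ‖K‖² < 1`), `infDistM_le_cUp_mul`
  — the "up to a constant" of [ApplegateEtAl2022, §3, p. 10 and the display following it].
* Lemma 4 in the `M`-geometry: `gap_add_eq`/`gap_eq_inner_sub` ((eq:bilinear-0):
  `G(z; ẑ) = F(z)ᵀ(z − ẑ)`), `norm_infeas_le` (test point 1, (eq:lp-1)), `dualityGap_le` (test point 2,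
  (eq:lp-2)–(eq:lp-3)), `kkt_residual_sum_le` (the Hoffman residual of the KKT system at a feasible
  `z` is `≤ ((√n + √m) c↑ + r + ‖z‖_M) ρ_r(z)`), `rho_lp_nonneg`.
* Lemma 5 in the `M`-geometry: **`isSharpOn_lp`** — on every ball `W_R(w) ∩ (ℝⁿ₊ × ℝᵐ)` of the
  `M`-seminorm the LP saddle is `α`-sharp in the sense of `RestartedPDHG.IsSharpOn` for an explicit
  `α > 0` built from the Hoffman constant; and the LP corollary of Theorem 1,
  **`lp_restartedPDHG_linear`**: fixed-frequency restarted PDHG started at a feasible point converges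
  linearly to the primal–dual solution set of a solvable LP.
* [ApplegateEtAl2022, §3.2, Lemma 3] (unconstrained bilinear saddles) in the same style:
  `mem_saddleSet_bilinear_iff` (`Z* = {Kx = b, c + K*y = 0}`), `bilNormal`/`bilRhs`/
  `mem_polyhedron_bil_iff` (the system `Hz = h`), `bddAbove_gap_ballM`, `rho_nonneg_of_mem`,
  `norm_F_le` (`‖F(z)‖₂ ≤ c↑ ρ_r(z)`, (eq:bilinear-1)), `bil_residual_sum_le`,
  **`isSharpOn_bilinear`** (ONE `α > 0` that works on every set `S` — global sharpness; the printed
  constant `σ_min⁺(A)` of Lemma 2 is replaced by the Hoffman constant of `{Hz = h}`, so `α` is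
  existential-explicit rather than spectral) and **`bilinear_restartedPDHG_linear`** (Theorem 1 +
  Lemma 3: restarted PDHG converges linearly from every start on solvable bilinear problems).
* Adaptive restarts on LP, [ApplegateEtAl2022, Theorem 2 with Lemma 5 and Proposition 9]:
  `exists_isSharpOn_restart_ball` (one feasible `M`-ball around the start that is sharp AND contains
  all restart points for any restart lengths — Proposition 9 (`RestartedPDHG.restart_mem_ballM`) +
  Lemma 5), **`lp_adaptive_restartedPDHG_linear`** (Thm 2 (ii) on LP:
  `dist_M(z^{n+1,0}, Z*) ≤ βⁿ (4/(ατ₀)) dist_M(z₀, Z*)` for every adaptive restart sequence) and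
  `lp_adaptive_length_le` (Thm 2 (i) on LP: first-hit restart lengths are `≤ t₁` whenever
  `4/(αt₁) ≤ β`).

Deviations from the printed text (the mechanism and the lemma order are as printed).
(i) [ApplegateEtAl2022, Lemmas 4–5] use the Euclidean norm and the ball `W_R(0)`; the restart
theorem (Theorem 1, tree: `infDistM_iterate_avgPDHG_le_pow`) needs sharpness on an `M`-ball around the
initial point, in the seminorm `‖·‖_M` of Proposition 1. Following the paper's own remark (§3, p. 10)
we prove the sharpness directly in that geometry, for any center `w`, carrying the comparison
constants `c↑, c↓` explicitly; hence the constant `α` differs from the printed `1/(H√(1+4R²))`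
(it is `1/(c↑ H ((√n + √m) c↑ + 3|R| + ‖w‖_M) + 1)` with `H` the `ℓ¹`-residual Hoffman constant of the
tree), the qualitative statement is the printed one. (ii) The strict step-size condition
`τσ‖K‖² < 1` (so that `‖·‖_M` is a norm, [ApplegateEtAl2022, display after the §3 remark]) replaces
`≤ 1`. (iii) Sign convention: the paper writes `L = cᵀx + yᵀb − yᵀAx`; the tree's `conicL` is the same
family with `A = −K`, `b ↦ −b`.
-/

namespace Literature.Analysis.Convex.LinearProgramSharpness

open scoped RealInnerProductSpace
open Literature.Analysis.Convex.PrimalDualHybridGradient (conicL shiftOp inner_metricM_self)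
open Literature.Analysis.Convex.RestartedPDHG
open Literature.Analysis.Convex.HoffmanErrorBound (polyhedron residual_nonneg hoffman)
open Literature.Analysis.Convex.MonotoneOperator (IsResolventMap)
open Literature.Analysis.Convex.DouglasRachford (normalCone)

variable {ιx ιy : Type*} [Fintype ιx] [Fintype ιy] [DecidableEq ιx] [DecidableEq ιy]

/-! ### The LP saddle: data, the nonnegative orthant, and the KKT description of its saddle points -/

/-- The nonnegative orthant `{x : x ≥ 0}` of `ℝ^{ιx}` — the primal constraint set `X = ℝⁿ₊` of the
LP Lagrangian `min_{x ≥ 0} max_y L(x, y)` (the same set literal as in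
`ProjectionOnSet.isClosestPoint_nonnegOrthant`, whose `orthantProj` is its Euclidean projection;
`EntropyMaximization.orthant` is the `ι → ℝ` version). [cite: ApplegateEtAl2022, §3.3 (20)–(22) (x ≥ 0)] -/
def orthant (ιx : Type*) [Fintype ιx] : Set (EuclideanSpace ℝ ιx) := {x | ∀ i, 0 ≤ x i}

omit [DecidableEq ιx] in
/-- Membership in the orthant. [cite: ApplegateEtAl2022, §3.3 (20)] -/
theorem mem_orthant_iff (x : EuclideanSpace ℝ ιx) : x ∈ orthant ιx ↔ ∀ i, 0 ≤ x i := Iff.rfl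

omit [DecidableEq ιx] in
/-- The orthant is convex. [cite: ApplegateEtAl2022, §3.3 (20)] -/
theorem convex_orthant : Convex ℝ (orthant ιx) := by
  intro x hx y hy a b ha hb _ i
  have h : (a • x + b • y) i = a * x i + b * y i := by simp
  rw [h]
  exact add_nonneg (mul_nonneg ha (hx i)) (mul_nonneg hb (hy i))

omit [DecidableEq ιx] in
/-- The real inner product of `ℝ^{ι}` in coordinates. [folklore] -/
private theorem inner_eq_sum {ι : Type*} [Fintype ι] (u v : EuclideanSpace ℝ ι) :
    ⟪u, v⟫ = ∑ i, u i * v i := by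
  rw [EuclideanSpace.inner_eq_star_dotProduct, star_trivial, dotProduct]
  exact Finset.sum_congr rfl fun i _ => mul_comm _ _

omit [DecidableEq ιx] in
/-- Coordinatewise nonnegative vectors have nonnegative inner product. [folklore] -/
private theorem inner_nonneg_of_nonneg {ι : Type*} [Fintype ι] {u v : EuclideanSpace ℝ ι}
    (hu : ∀ i, 0 ≤ u i) (hv : ∀ i, 0 ≤ v i) : 0 ≤ ⟪u, v⟫ := by
  rw [inner_eq_sum]
  exact Finset.sum_nonneg fun i _ => mul_nonneg (hu i) (hv i)

omit [DecidableEq ιx] [DecidableEq ιy] in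
/-- The LP Lagrangian as a function of `x` at fixed `y`: `L(x, y) = ⟨c + K* y, x⟩ − ⟨b, y⟩` (the
dual slack `c + K* y` is its `x`-gradient). [cite: ApplegateEtAl2022, §3.2 (17) (∇_x L)] -/
theorem conicL_eq_inner_dualSlack (K : EuclideanSpace ℝ ιx →L[ℝ] EuclideanSpace ℝ ιy)
    (c : EuclideanSpace ℝ ιx) (b : EuclideanSpace ℝ ιy) (x : EuclideanSpace ℝ ιx)
    (y : EuclideanSpace ℝ ιy) : conicL K c b x y = ⟪c + K.adjoint y, x⟫ - ⟪b, y⟫ := by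
  unfold conicL
  rw [inner_add_left, ContinuousLinearMap.adjoint_inner_left, real_inner_comm (K x)]

omit [DecidableEq ιx] [DecidableEq ιy] in
/-- The LP Lagrangian as a function of `y` at fixed `x`: `L(x, y) = ⟨c, x⟩ + ⟨K x − b, y⟩` (the
primal residual `K x − b` is its `y`-gradient). [cite: ApplegateEtAl2022, §3.2 (17) (∇_y L)] -/
theorem conicL_eq_inner_primalRes (K : EuclideanSpace ℝ ιx →L[ℝ] EuclideanSpace ℝ ιy)
    (c : EuclideanSpace ℝ ιx) (b : EuclideanSpace ℝ ιy) (x : EuclideanSpace ℝ ιx)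
    (y : EuclideanSpace ℝ ιy) : conicL K c b x y = ⟪c, x⟫ + ⟪K x - b, y⟫ := by
  unfold conicL
  rw [inner_sub_left]
  ring

omit [DecidableEq ιy] in
/-- **The saddle points of the LP Lagrangian are the KKT points.** For
`L(x, y) = ⟨c, x⟩ + ⟨Kx, y⟩ − ⟨b, y⟩` on `X × Y = ℝⁿ₊ × ℝᵐ` (the Lagrangian of `min ⟨c, x⟩ s.t.
Kx = b, x ≥ 0`, dual `max −⟨b, y⟩ s.t. c + K* y ≥ 0`), `(x̄, ȳ)` is a saddle point iff `x̄ ≥ 0`,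
`K x̄ = b`, `c + K* ȳ ≥ 0` and the duality gap `⟨c, x̄⟩ + ⟨b, ȳ⟩ ≤ 0` (equivalently complementary
slackness) — "by strong duality we can reduce (20) and (21) to solving the system `Kz ≥ h`".
[cite: ApplegateEtAl2022, §3.3 ((20)–(22) and the system Kz ≥ h)] -/
theorem mem_saddleSet_lp_iff (K : EuclideanSpace ℝ ιx →L[ℝ] EuclideanSpace ℝ ιy)
    (c : EuclideanSpace ℝ ιx) (b : EuclideanSpace ℝ ιy)
    (z : EuclideanSpace ℝ ιx × EuclideanSpace ℝ ιy) :
    z ∈ saddleSet K (orthant ιx) Set.univ c b ↔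
      (∀ i, 0 ≤ z.1 i) ∧ K z.1 = b ∧ (∀ i, 0 ≤ (c + K.adjoint z.2) i) ∧
        ⟪c, z.1⟫ + ⟪b, z.2⟫ ≤ 0 := by
  rw [mem_saddleSet_iff]
  -- the identity `⟨c, x⟩ + ⟨b, y⟩ = ⟨c + K*y, x⟩ − ⟨Kx − b, y⟩`
  have hgap : ⟪c, z.1⟫ + ⟪b, z.2⟫ = ⟪c + K.adjoint z.2, z.1⟫ - ⟪K z.1 - b, z.2⟫ := by
    rw [inner_add_left, ContinuousLinearMap.adjoint_inner_left, inner_sub_left,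
      real_inner_comm (K z.1)]
    ring
  constructor
  · rintro ⟨hx, -, hmin, hmax⟩
    have hx' : ∀ i, 0 ≤ z.1 i := hx
    -- `K x̄ = b`: test `y = ȳ + (K x̄ − b)`
    have hres : K z.1 - b = 0 := by
      have h := hmax (z.2 + (K z.1 - b)) (Set.mem_univ _)
      rw [conicL_eq_inner_primalRes, conicL_eq_inner_primalRes, inner_add_right,
        real_inner_self_eq_norm_sq] at h
      have h0 : ‖K z.1 - b‖ ^ 2 ≤ 0 := by linarith
      have h1 : ‖K z.1 - b‖ = 0 := by nlinarith [norm_nonneg (K z.1 - b)]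
      exact norm_eq_zero.mp h1
    have hKb : K z.1 = b := sub_eq_zero.mp hres
    -- `c + K* ȳ ≥ 0`: test `x = x̄ + e_i`
    have hslack : ∀ i, 0 ≤ (c + K.adjoint z.2) i := by
      intro i
      have hmem : z.1 + EuclideanSpace.single i (1 : ℝ) ∈ orthant ιx := by
        intro j
        have : (z.1 + EuclideanSpace.single i (1 : ℝ)) j = z.1 j + ite (j = i) 1 0 := by simp
        rw [this]
        exact add_nonneg (hx' j) (by split_ifs <;> norm_num)
      have h := hmin _ hmem
      rw [conicL_eq_inner_dualSlack, conicL_eq_inner_dualSlack, inner_add_right,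
        EuclideanSpace.inner_single_right] at h
      simpa using h
    -- the gap: test `x = 0`
    have hgap' : ⟪c + K.adjoint z.2, z.1⟫ ≤ 0 := by
      have hmem : (0 : EuclideanSpace ℝ ιx) ∈ orthant ιx := fun j => by simp
      have h := hmin _ hmem
      rw [conicL_eq_inner_dualSlack, conicL_eq_inner_dualSlack, inner_zero_right] at h
      linarith
    refine ⟨hx', hKb, hslack, ?_⟩
    rw [hgap, hres, inner_zero_left, sub_zero]
    exact hgap'
  · rintro ⟨hx, hKb, hslack, hgap'⟩
    have hres : K z.1 - b = 0 := sub_eq_zero.mpr hKb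
    refine ⟨hx, Set.mem_univ _, fun x hxC => ?_, fun y _ => ?_⟩
    · rw [conicL_eq_inner_dualSlack, conicL_eq_inner_dualSlack]
      have h1 : 0 ≤ ⟪c + K.adjoint z.2, x⟫ := inner_nonneg_of_nonneg hslack hxC
      have h2 : ⟪c + K.adjoint z.2, z.1⟫ ≤ 0 := by
        rw [hgap, hres, inner_zero_left, sub_zero] at hgap'
        exact hgap'
      linarith
    · rw [conicL_eq_inner_primalRes, conicL_eq_inner_primalRes, hres, inner_zero_left,
        inner_zero_left]

/-! ### The KKT polyhedron in `Z = X × Y` and Hoffman's residual -/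

/-- Index of the rows of the KKT system `Kz ≥ h` of [ApplegateEtAl2022, §3.3]: primal sign rows
`x ≥ 0`, primal equality rows `Kx = b` (two inequalities each), dual feasibility rows `c + K*y ≥ 0`,
and the duality-gap row. [cite: ApplegateEtAl2022, §3.3 (K and h)] -/
abbrev KKTRow (ιx ιy : Type*) := ιx ⊕ ((ιy ⊕ ιy) ⊕ (ιx ⊕ Unit))

/-- The normals of the KKT system, written as `⟨a_ρ, z⟩ ≤ h_ρ` in the Hilbert space `Z = X × Y`
(`WithLp 2`): `−x_i ≤ 0`; `(Kx)_j ≤ b_j` and `−(Kx)_j ≤ −b_j`; `−(K*y)_i ≤ c_i`; `⟨c, x⟩ + ⟨b, y⟩ ≤ 0`.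
[cite: ApplegateEtAl2022, §3.3 (K and h)] -/
noncomputable def kktNormal (K : EuclideanSpace ℝ ιx →L[ℝ] EuclideanSpace ℝ ιy)
    (c : EuclideanSpace ℝ ιx) (b : EuclideanSpace ℝ ιy) :
    KKTRow ιx ιy → WithLp 2 (EuclideanSpace ℝ ιx × EuclideanSpace ℝ ιy)
  | Sum.inl i => WithLp.toLp 2 (-EuclideanSpace.single i (1 : ℝ), 0)
  | Sum.inr (Sum.inl (Sum.inl j)) => WithLp.toLp 2 (K.adjoint (EuclideanSpace.single j (1 : ℝ)), 0)
  | Sum.inr (Sum.inl (Sum.inr j)) => WithLp.toLp 2 (-K.adjoint (EuclideanSpace.single j (1 : ℝ)), 0)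
  | Sum.inr (Sum.inr (Sum.inl i)) => WithLp.toLp 2 (0, -K (EuclideanSpace.single i (1 : ℝ)))
  | Sum.inr (Sum.inr (Sum.inr _)) => WithLp.toLp 2 (c, b)

/-- The right-hand sides of the KKT system. [cite: ApplegateEtAl2022, §3.3 (K and h)] -/
noncomputable def kktRhs (c : EuclideanSpace ℝ ιx) (b : EuclideanSpace ℝ ιy) : KKTRow ιx ιy → ℝ
  | Sum.inl _ => 0
  | Sum.inr (Sum.inl (Sum.inl j)) => b j
  | Sum.inr (Sum.inl (Sum.inr j)) => -b j
  | Sum.inr (Sum.inr (Sum.inl i)) => c i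
  | Sum.inr (Sum.inr (Sum.inr _)) => 0

/-- The five families of linear forms of the KKT system evaluated at `z = (x, y)`.
[cite: ApplegateEtAl2022, §3.3 (K and h)] -/
theorem inner_kktNormal (K : EuclideanSpace ℝ ιx →L[ℝ] EuclideanSpace ℝ ιy)
    (c : EuclideanSpace ℝ ιx) (b : EuclideanSpace ℝ ιy)
    (z : EuclideanSpace ℝ ιx × EuclideanSpace ℝ ιy) (ρ : KKTRow ιx ιy) :
    ⟪kktNormal K c b ρ, WithLp.toLp 2 z⟫ =
      match ρ with
      | Sum.inl i => -z.1 i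
      | Sum.inr (Sum.inl (Sum.inl j)) => (K z.1) j
      | Sum.inr (Sum.inl (Sum.inr j)) => -(K z.1) j
      | Sum.inr (Sum.inr (Sum.inl i)) => -(K.adjoint z.2) i
      | Sum.inr (Sum.inr (Sum.inr _)) => ⟪c, z.1⟫ + ⟪b, z.2⟫ := by
  rcases ρ with i | ((j | j) | (i | u))
  · simp [kktNormal, WithLp.prod_inner_apply, EuclideanSpace.inner_single_left]
  · simp [kktNormal, WithLp.prod_inner_apply, ContinuousLinearMap.adjoint_inner_left,
      EuclideanSpace.inner_single_left]
  · simp [kktNormal, WithLp.prod_inner_apply, inner_neg_left, ContinuousLinearMap.adjoint_inner_left,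
      EuclideanSpace.inner_single_left]
  · simp [kktNormal, WithLp.prod_inner_apply, inner_neg_left, ← ContinuousLinearMap.adjoint_inner_right,
      EuclideanSpace.inner_single_left]
  · simp [kktNormal, WithLp.prod_inner_apply]

/-- **`Z*` is the KKT polyhedron**: `z` is a saddle point of the LP Lagrangian iff `z` solves the
system `Kz ≥ h` ("by strong duality we can reduce (20) and (21) to solving the system `Kz ≥ h`").
[cite: ApplegateEtAl2022, §3.3 (the system Kz ≥ h)] -/
theorem mem_polyhedron_kkt_iff (K : EuclideanSpace ℝ ιx →L[ℝ] EuclideanSpace ℝ ιy)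
    (c : EuclideanSpace ℝ ιx) (b : EuclideanSpace ℝ ιy)
    (z : EuclideanSpace ℝ ιx × EuclideanSpace ℝ ιy) :
    WithLp.toLp 2 z ∈ polyhedron (kktNormal K c b) (kktRhs c b) ↔
      z ∈ saddleSet K (orthant ιx) Set.univ c b := by
  rw [mem_saddleSet_lp_iff, HoffmanErrorBound.mem_polyhedron_iff]
  constructor
  · intro h
    have h1 : ∀ i, 0 ≤ z.1 i := fun i => by
      have := h (Sum.inl i); rw [inner_kktNormal] at this; simpa [kktRhs] using this
    have h2 : ∀ j, (K z.1) j = b j := fun j => by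
      have ha := h (Sum.inr (Sum.inl (Sum.inl j)))
      have hb := h (Sum.inr (Sum.inl (Sum.inr j)))
      rw [inner_kktNormal] at ha hb
      simp only [kktRhs] at ha hb
      linarith
    have h3 : ∀ i, 0 ≤ (c + K.adjoint z.2) i := fun i => by
      have := h (Sum.inr (Sum.inr (Sum.inl i))); rw [inner_kktNormal] at this
      simp only [kktRhs] at this
      have e : (c + K.adjoint z.2) i = c i + (K.adjoint z.2) i := by simp
      rw [e]; linarith
    have h4 : ⟪c, z.1⟫ + ⟪b, z.2⟫ ≤ 0 := by
      have := h (Sum.inr (Sum.inr (Sum.inr ()))); rw [inner_kktNormal] at this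
      simpa [kktRhs] using this
    exact ⟨h1, PiLp.ext h2, h3, h4⟩
  · rintro ⟨h1, h2, h3, h4⟩ ρ
    rw [inner_kktNormal]
    rcases ρ with i | ((j | j) | (i | u))
    · simpa [kktRhs] using h1 i
    · simp [kktRhs, h2]
    · simp [kktRhs, h2]
    · have e : (c + K.adjoint z.2) i = c i + (K.adjoint z.2) i := by simp
      have := h3 i
      rw [e] at this
      simp only [kktRhs]
      linarith
    · simpa [kktRhs] using h4

/-- Consequently `dist` in `Z = X × Y` to the KKT polyhedron is the distance to `Z*` (image under
`toLp`). [cite: ApplegateEtAl2022, §3.3 (Z* = {z : Kz ≥ h})] -/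
theorem polyhedron_kkt_eq (K : EuclideanSpace ℝ ιx →L[ℝ] EuclideanSpace ℝ ιy)
    (c : EuclideanSpace ℝ ιx) (b : EuclideanSpace ℝ ιy) :
    polyhedron (kktNormal K c b) (kktRhs c b) =
      (WithLp.toLp 2) '' saddleSet K (orthant ιx) Set.univ c b := by
  ext w
  constructor
  · intro hw
    refine ⟨WithLp.ofLp w, ?_, rfl⟩
    rw [← mem_polyhedron_kkt_iff]
    exact hw
  · rintro ⟨z, hz, rfl⟩
    exact (mem_polyhedron_kkt_iff K c b z).mpr hz

/-! ### Comparing the `M`-seminorm with the Euclidean norm of `Z = X × Y` -/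

section NormComparison

variable {X Y : Type*} [NormedAddCommGroup X] [InnerProductSpace ℝ X] [CompleteSpace X]
  [NormedAddCommGroup Y] [InnerProductSpace ℝ Y] [CompleteSpace Y]

/-- The upper comparison constant `c↑ = √(1/τ + 1/σ + ‖K‖)`. [cite: ApplegateEtAl2022, §3 (remark after Definition 1: "for any other norms, the sharpness condition still holds (up to a constant)")] -/
noncomputable def cUp (K : X →L[ℝ] Y) (τ σ : ℝ) : ℝ := Real.sqrt (τ⁻¹ + σ⁻¹ + ‖K‖)

/-- The lower comparison constant `c↓ = √((1 − √(τσ)‖K‖) · min(1/τ, 1/σ))`.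
[cite: ApplegateEtAl2022, §3 (remark after Definition 1)] -/
noncomputable def cLow (K : X →L[ℝ] Y) (τ σ : ℝ) : ℝ :=
  Real.sqrt ((1 - Real.sqrt (τ * σ) * ‖K‖) * min τ⁻¹ σ⁻¹)

omit [CompleteSpace X] [CompleteSpace Y] in
/-- `c↑ ≥ 0`. [cite: ApplegateEtAl2022, §3 (remark after Definition 1)] -/
theorem cUp_nonneg (K : X →L[ℝ] Y) (τ σ : ℝ) : 0 ≤ cUp K τ σ := Real.sqrt_nonneg _

/-- **`‖d‖_M ≤ c↑ ‖d‖₂`** for `τ, σ > 0` (Cauchy–Schwarz on the coupling term).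
[cite: ApplegateEtAl2022, §3 (remark after Definition 1: equivalence of norms)] -/
theorem normM_le_cUp_mul (K : X →L[ℝ] Y) {τ σ : ℝ} (hτ : 0 < τ) (hσ : 0 < σ) (d : X × Y) :
    normM K τ σ d ≤ cUp K τ σ * ‖WithLp.toLp 2 d‖ := by
  have hq : qM K τ σ d ≤ (τ⁻¹ + σ⁻¹ + ‖K‖) * ‖WithLp.toLp 2 d‖ ^ 2 := by
    rw [qM_eq, inner_metricM_self, WithLp.prod_norm_sq_eq_of_L2]
    simp only [WithLp.toLp_fst, WithLp.toLp_snd]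
    have hK : |⟪K d.1, d.2⟫| ≤ ‖K‖ * ‖d.1‖ * ‖d.2‖ := by
      calc |⟪K d.1, d.2⟫| ≤ ‖K d.1‖ * ‖d.2‖ := abs_real_inner_le_norm _ _
        _ ≤ ‖K‖ * ‖d.1‖ * ‖d.2‖ := mul_le_mul_of_nonneg_right (K.le_opNorm _) (norm_nonneg _)
    have h2 : -(2 * ⟪K d.1, d.2⟫) ≤ ‖K‖ * (‖d.1‖ ^ 2 + ‖d.2‖ ^ 2) := by
      have h3 : 2 * (‖d.1‖ * ‖d.2‖) ≤ ‖d.1‖ ^ 2 + ‖d.2‖ ^ 2 := by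
        nlinarith [sq_nonneg (‖d.1‖ - ‖d.2‖)]
      have h4 := (abs_le.mp hK).1
      nlinarith [norm_nonneg K, h4, h3]
    have hτ' : 0 ≤ τ⁻¹ := by positivity
    have hσ' : 0 ≤ σ⁻¹ := by positivity
    nlinarith [h2, mul_nonneg hτ' (sq_nonneg ‖d.2‖), mul_nonneg hσ' (sq_nonneg ‖d.1‖),
      mul_nonneg (norm_nonneg K) (sq_nonneg ‖d.1‖), mul_nonneg (norm_nonneg K) (sq_nonneg ‖d.2‖)]
  unfold normM cUp
  rw [← Real.sqrt_sq (norm_nonneg (WithLp.toLp 2 d)), ← Real.sqrt_mul (by positivity)]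
  exact Real.sqrt_le_sqrt hq

/-- **`c↓ ‖d‖₂ ≤ ‖d‖_M`** for `τ, σ > 0`, `τσ‖K‖² ≤ 1` (from the tree's coercivity estimate
`euclidean_le_normM_sq`); `c↓ > 0` as soon as `τσ‖K‖² < 1`.
[cite: ApplegateEtAl2022, §3 (remark after Definition 1: equivalence of norms)] -/
theorem cLow_mul_le_normM (K : X →L[ℝ] Y) {τ σ : ℝ} (hτ : 0 < τ) (hσ : 0 < σ)
    (hK : τ * σ * ‖K‖ ^ 2 ≤ 1) (d : X × Y) :
    cLow K τ σ * ‖WithLp.toLp 2 d‖ ≤ normM K τ σ d := by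
  have hcoef : 0 ≤ 1 - Real.sqrt (τ * σ) * ‖K‖ := by
    have h0 : 0 ≤ Real.sqrt (τ * σ) * ‖K‖ := by positivity
    have h1 : (Real.sqrt (τ * σ) * ‖K‖) ^ 2 ≤ 1 := by
      rw [mul_pow, Real.sq_sqrt (by positivity)]; exact hK
    nlinarith
  have h := euclidean_le_normM_sq K hτ hσ hK d
  have hmin : (1 - Real.sqrt (τ * σ) * ‖K‖) * min τ⁻¹ σ⁻¹ * ‖WithLp.toLp 2 d‖ ^ 2 ≤
      normM K τ σ d ^ 2 := by
    rw [WithLp.prod_norm_sq_eq_of_L2]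
    simp only [WithLp.toLp_fst, WithLp.toLp_snd]
    have h1 : min τ⁻¹ σ⁻¹ * ‖d.1‖ ^ 2 ≤ τ⁻¹ * ‖d.1‖ ^ 2 :=
      mul_le_mul_of_nonneg_right (min_le_left _ _) (sq_nonneg _)
    have h2 : min τ⁻¹ σ⁻¹ * ‖d.2‖ ^ 2 ≤ σ⁻¹ * ‖d.2‖ ^ 2 :=
      mul_le_mul_of_nonneg_right (min_le_right _ _) (sq_nonneg _)
    nlinarith [h, h1, h2, hcoef]
  have hnn : 0 ≤ (1 - Real.sqrt (τ * σ) * ‖K‖) * min τ⁻¹ σ⁻¹ :=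
    mul_nonneg hcoef (le_min (by positivity) (by positivity))
  unfold cLow
  rw [← Real.sqrt_sq (norm_nonneg (WithLp.toLp 2 d)), ← Real.sqrt_mul hnn,
    ← Real.sqrt_sq (normM_nonneg K τ σ d)]
  exact Real.sqrt_le_sqrt hmin

omit [CompleteSpace X] [CompleteSpace Y] in
/-- `c↓ > 0` when `τσ‖K‖² < 1`. [cite: ApplegateEtAl2022, §3 (remark after Definition 1)] -/
theorem cLow_pos (K : X →L[ℝ] Y) {τ σ : ℝ} (hτ : 0 < τ) (hσ : 0 < σ)
    (hK : τ * σ * ‖K‖ ^ 2 < 1) : 0 < cLow K τ σ := by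
  have hcoef : 0 < 1 - Real.sqrt (τ * σ) * ‖K‖ := by
    have h0 : 0 ≤ Real.sqrt (τ * σ) * ‖K‖ := by positivity
    have h1 : (Real.sqrt (τ * σ) * ‖K‖) ^ 2 < 1 := by
      rw [mul_pow, Real.sq_sqrt (by positivity)]; exact hK
    nlinarith
  unfold cLow
  exact Real.sqrt_pos.mpr (mul_pos hcoef (lt_min (by positivity) (by positivity)))

/-- Distances compare accordingly: `dist_M(z, S) ≤ c↑ · ‖z − w‖₂` for any `w ∈ S`.
[cite: ApplegateEtAl2022, §3 (remark after Definition 1)] -/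
theorem infDistM_le_cUp_mul (K : X →L[ℝ] Y) {τ σ : ℝ} (hτ : 0 < τ) (hσ : 0 < σ) (z : X × Y)
    {S : Set (X × Y)} {w : X × Y} (hw : w ∈ S) :
    infDistM K τ σ z S ≤ cUp K τ σ * ‖WithLp.toLp 2 z - WithLp.toLp 2 w‖ := by
  rw [← WithLp.toLp_sub]
  exact (infDistM_le K τ σ z hw).trans (normM_le_cUp_mul K hτ hσ _)

end NormComparison

/-! ### The gap of the LP saddle against test points ([ApplegateEtAl2022, Lemma 4]) -/

omit [DecidableEq ιx] [DecidableEq ιy] in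
/-- The gap against a displaced point is bilinear in the KKT residuals:
`G(z; z + d) = ⟨Kx − b, d_y⟩ − ⟨c + K*y, d_x⟩` (`= F(z)ᵀ(z − ẑ)`). [cite: ApplegateEtAl2022, §3.2 (17)] -/
theorem gap_add_eq (K : EuclideanSpace ℝ ιx →L[ℝ] EuclideanSpace ℝ ιy) (c : EuclideanSpace ℝ ιx)
    (b : EuclideanSpace ℝ ιy) (z d : EuclideanSpace ℝ ιx × EuclideanSpace ℝ ιy) :
    gap K c b z (z + d) = ⟪K z.1 - b, d.2⟫ - ⟪c + K.adjoint z.2, d.1⟫ := by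
  unfold gap conicL
  simp only [Prod.fst_add, Prod.snd_add, map_add, inner_add_left, inner_add_right, inner_sub_left,
    ContinuousLinearMap.adjoint_inner_left]
  rw [real_inner_comm (K d.1) z.2]
  ring

omit [DecidableEq ιx] [DecidableEq ιy] in
/-- The gap against any point, through the displacement `ζ − z`:
`G(z; ζ) = ⟨Kx − b, (ζ − z)_y⟩ − ⟨c + K*y, (ζ − z)_x⟩`. [cite: ApplegateEtAl2022, §3.2 (17)] -/
theorem gap_eq_inner_sub (K : EuclideanSpace ℝ ιx →L[ℝ] EuclideanSpace ℝ ιy)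
    (c : EuclideanSpace ℝ ιx) (b : EuclideanSpace ℝ ιy)
    (z ζ : EuclideanSpace ℝ ιx × EuclideanSpace ℝ ιy) :
    gap K c b z ζ = ⟪K z.1 - b, (ζ - z).2⟫ - ⟪c + K.adjoint z.2, (ζ - z).1⟫ := by
  rw [← gap_add_eq, add_sub_cancel]

/-- The negative part `(−g)₊` of a vector, coordinatewise: the violation of `g ≥ 0`.
[cite: ApplegateEtAl2022, Lemma 4 (proof: v = ((−c + Aᵀy)⁺, b − Ax))] -/
noncomputable def negPart (g : EuclideanSpace ℝ ιx) : EuclideanSpace ℝ ιx :=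
  WithLp.toLp 2 (fun i => max (-g i) 0)

omit [Fintype ιx] [DecidableEq ιx] in
/-- Coordinates of the negative part. [cite: ApplegateEtAl2022, Lemma 4 (proof)] -/
theorem negPart_apply (g : EuclideanSpace ℝ ιx) (i : ιx) : negPart g i = max (-g i) 0 := rfl

omit [Fintype ιx] [DecidableEq ιx] in
/-- The negative part is nonnegative. [cite: ApplegateEtAl2022, Lemma 4 (proof)] -/
theorem negPart_nonneg (g : EuclideanSpace ℝ ιx) (i : ιx) : 0 ≤ negPart g i := by
  rw [negPart_apply]; exact le_max_right _ _

omit [DecidableEq ιx] in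
/-- `−⟨g, (−g)₊⟩ = ‖(−g)₊‖²`. [cite: ApplegateEtAl2022, Lemma 4 (proof, (eq:lp-1))] -/
theorem neg_inner_negPart (g : EuclideanSpace ℝ ιx) : -⟪g, negPart g⟫ = ‖negPart g‖ ^ 2 := by
  rw [inner_eq_sum, EuclideanSpace.real_norm_sq_eq, ← Finset.sum_neg_distrib]
  refine Finset.sum_congr rfl fun i _ => ?_
  rw [negPart_apply]
  rcases le_or_gt 0 (g i) with h | h
  · rw [max_eq_right (by linarith)]; ring
  · rw [max_eq_left (by linarith)]; ring

omit [DecidableEq ιx] [DecidableEq ιy] in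
/-- **Test point 1** ([ApplegateEtAl2022, Lemma 4, (eq:lp-1)], in the `M`-geometry): for feasible
`z = (x, y)` (`x ≥ 0`) and `r > 0`, with `d = ((−(c + K*y))₊, Kx − b)` the vector of dual and primal
infeasibilities, `‖d‖₂ ≤ c↑ · ρ_r(z)` — move from `z` along `d` to the boundary of the `M`-ball
(the point stays feasible since `d_x ≥ 0`) and read off `G = ‖d‖₂² · (step)`.
[cite: ApplegateEtAl2022, Lemma 4 (proof, (eq:lp-1))] -/
theorem norm_infeas_le (K : EuclideanSpace ℝ ιx →L[ℝ] EuclideanSpace ℝ ιy)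
    (c : EuclideanSpace ℝ ιx) (b : EuclideanSpace ℝ ιy) {τ σ : ℝ} (hτ : 0 < τ) (hσ : 0 < σ)
    (hK : τ * σ * ‖K‖ ^ 2 < 1) {z : EuclideanSpace ℝ ιx × EuclideanSpace ℝ ιy}
    (hz : z.1 ∈ orthant ιx) {r : ℝ} (hr : 0 < r) :
    ‖WithLp.toLp 2 (negPart (c + K.adjoint z.2), K z.1 - b)‖ ≤
      cUp K τ σ * rho K (orthant ιx) Set.univ c b τ σ r z := by
  set d : EuclideanSpace ℝ ιx × EuclideanSpace ℝ ιy := (negPart (c + K.adjoint z.2), K z.1 - b)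
    with hd
  set nd := ‖WithLp.toLp 2 d‖ with hnd
  have hnd0 : 0 ≤ nd := norm_nonneg _
  -- the gap set over the `M`-ball is bounded above and contains `0`
  set S := (fun ζ => gap K c b z ζ) ''
    {ζ : EuclideanSpace ℝ ιx × EuclideanSpace ℝ ιy |
      ζ.1 ∈ orthant ιx ∧ ζ.2 ∈ Set.univ ∧ normM K τ σ (ζ - z) ≤ r} with hS
  have hcL := cLow_pos K hτ hσ hK
  have hbdd : BddAbove S := by
    refine ⟨(‖K z.1 - b‖ + ‖c + K.adjoint z.2‖) * (r / cLow K τ σ), ?_⟩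
    rintro _ ⟨ζ, ⟨-, -, hζ⟩, rfl⟩
    show gap K c b z ζ ≤ _
    rw [gap_eq_inner_sub]
    have hE : ‖WithLp.toLp 2 (ζ - z)‖ ≤ r / cLow K τ σ := by
      rw [le_div_iff₀ hcL, mul_comm]
      exact (cLow_mul_le_normM K hτ hσ hK.le (ζ - z)).trans hζ
    have h1 : ‖(ζ - z).2‖ ≤ ‖WithLp.toLp 2 (ζ - z)‖ := by
      have := WithLp.norm_snd_le (x := WithLp.toLp 2 (ζ - z)); simpa using this
    have h2 : ‖(ζ - z).1‖ ≤ ‖WithLp.toLp 2 (ζ - z)‖ := by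
      have := WithLp.norm_fst_le (x := WithLp.toLp 2 (ζ - z)); simpa using this
    have i1 : ⟪K z.1 - b, (ζ - z).2⟫ ≤ ‖K z.1 - b‖ * ‖(ζ - z).2‖ := real_inner_le_norm _ _
    have i2 : -⟪c + K.adjoint z.2, (ζ - z).1⟫ ≤ ‖c + K.adjoint z.2‖ * ‖(ζ - z).1‖ := by
      rw [← inner_neg_right]
      exact (real_inner_le_norm _ _).trans (by rw [norm_neg])
    nlinarith [norm_nonneg (K z.1 - b), norm_nonneg (c + K.adjoint z.2), h1, h2, hE,
      norm_nonneg (ζ - z).1, norm_nonneg (ζ - z).2]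
  have hz0 : gap K c b z z ∈ S := ⟨z, ⟨hz, Set.mem_univ _, by rw [sub_self, normM_zero]; exact hr.le⟩, rfl⟩
  have hρ0 : 0 ≤ rho K (orthant ιx) Set.univ c b τ σ r z := by
    unfold rho
    refine mul_nonneg (inv_nonneg.mpr hr.le) ?_
    have h := le_csSup hbdd hz0
    rwa [gap_self] at h
  rcases hnd0.eq_or_lt with hnd00 | hndpos
  · rw [← hnd00]
    exact mul_nonneg (cUp_nonneg K τ σ) hρ0
  -- the test point `ζ = z + s d`, `s = r / ‖d‖_M`
  have hdM : 0 < normM K τ σ d :=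
    lt_of_lt_of_le (mul_pos hcL hndpos) (cLow_mul_le_normM K hτ hσ hK.le d)
  set s := r / normM K τ σ d with hs
  have hs0 : 0 < s := div_pos hr hdM
  have hmem : gap K c b z (z + s • d) ∈ S := by
    refine ⟨z + s • d, ⟨?_, Set.mem_univ _, ?_⟩, rfl⟩
    · intro i
      have e : (z + s • d).1 i = z.1 i + s * negPart (c + K.adjoint z.2) i := by
        simp [hd]
      rw [e]
      exact add_nonneg (hz i) (mul_nonneg hs0.le (negPart_nonneg _ i))
    · rw [add_sub_cancel_left, normM_smul, abs_of_pos hs0, hs, div_mul_cancel₀ r hdM.ne']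
  -- its gap is `s ‖d‖₂²`
  have hgap : gap K c b z (z + s • d) = s * nd ^ 2 := by
    rw [gap_add_eq]
    simp only [hd, Prod.smul_snd, Prod.smul_fst, inner_smul_right]
    rw [hnd, WithLp.prod_norm_sq_eq_of_L2]
    simp only [WithLp.toLp_fst, WithLp.toLp_snd, hd]
    rw [real_inner_self_eq_norm_sq, ← neg_inner_negPart]
    ring
  -- hence `ρ_r(z) ≥ s ‖d‖₂² / r = ‖d‖₂² / ‖d‖_M ≥ ‖d‖₂ / c↑`
  have hle : s * nd ^ 2 ≤ r * rho K (orthant ιx) Set.univ c b τ σ r z := by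
    have h := le_csSup hbdd hmem
    rw [hgap] at h
    unfold rho
    rw [← mul_assoc, mul_inv_cancel₀ hr.ne', one_mul]
    exact h
  have hup : normM K τ σ d ≤ cUp K τ σ * nd := normM_le_cUp_mul K hτ hσ d
  have hcU : 0 < cUp K τ σ := by
    by_contra h
    push Not at h
    have : normM K τ σ d ≤ 0 := hup.trans (mul_nonpos_of_nonpos_of_nonneg h hnd0)
    linarith
  -- `nd² · r / ‖d‖_M ≤ r ρ` ⇒ `nd² ≤ ‖d‖_M ρ ≤ c↑ nd ρ` ⇒ `nd ≤ c↑ ρ`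
  have h1 : nd ^ 2 * r ≤ r * rho K (orthant ιx) Set.univ c b τ σ r z * normM K τ σ d := by
    have := mul_le_mul_of_nonneg_right hle hdM.le
    rw [hs] at this
    calc nd ^ 2 * r = r / normM K τ σ d * nd ^ 2 * normM K τ σ d := by
          field_simp
      _ ≤ r * rho K (orthant ιx) Set.univ c b τ σ r z * normM K τ σ d := this
  have h2 : nd ^ 2 ≤ rho K (orthant ιx) Set.univ c b τ σ r z * normM K τ σ d := by
    have : r * nd ^ 2 ≤ r * (rho K (orthant ιx) Set.univ c b τ σ r z * normM K τ σ d) := by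
      linarith
    exact le_of_mul_le_mul_left this hr
  have h3 : nd ^ 2 ≤ rho K (orthant ιx) Set.univ c b τ σ r z * (cUp K τ σ * nd) :=
    h2.trans (mul_le_mul_of_nonneg_left hup hρ0)
  have h4 : nd * nd ≤ nd * (cUp K τ σ * rho K (orthant ιx) Set.univ c b τ σ r z) := by
    nlinarith
  exact le_of_mul_le_mul_left h4 hndpos

omit [DecidableEq ιx] [DecidableEq ιy] in
/-- **Test point 2** ([ApplegateEtAl2022, Lemma 4, (eq:lp-2)–(eq:lp-3)], in the `M`-geometry): for
feasible `z` and `r > 0` the duality gap satisfies `(⟨c, x⟩ + ⟨b, y⟩)₊ ≤ (r + ‖z‖_M) · ρ_r(z)` — shrink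
`z` towards `0` by the factor `1 − s`, `s = min(1, r/‖z‖_M)` (the point stays feasible), whose gap is
`s(⟨c, x⟩ + ⟨b, y⟩)`. [cite: ApplegateEtAl2022, Lemma 4 (proof, (eq:lp-2), (eq:lp-3))] -/
theorem dualityGap_le (K : EuclideanSpace ℝ ιx →L[ℝ] EuclideanSpace ℝ ιy)
    (c : EuclideanSpace ℝ ιx) (b : EuclideanSpace ℝ ιy) {τ σ : ℝ} (hτ : 0 < τ) (hσ : 0 < σ)
    (hK : τ * σ * ‖K‖ ^ 2 < 1) {z : EuclideanSpace ℝ ιx × EuclideanSpace ℝ ιy}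
    (hz : z.1 ∈ orthant ιx) {r : ℝ} (hr : 0 < r) :
    max (⟪c, z.1⟫ + ⟪b, z.2⟫) 0 ≤ (r + normM K τ σ z) * rho K (orthant ιx) Set.univ c b τ σ r z := by
  set G := ⟪c, z.1⟫ + ⟪b, z.2⟫ with hG
  set S := (fun ζ => gap K c b z ζ) ''
    {ζ : EuclideanSpace ℝ ιx × EuclideanSpace ℝ ιy |
      ζ.1 ∈ orthant ιx ∧ ζ.2 ∈ Set.univ ∧ normM K τ σ (ζ - z) ≤ r} with hS
  have hcL := cLow_pos K hτ hσ hK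
  -- boundedness and `ρ ≥ 0`, as before
  have hbdd : BddAbove S := by
    refine ⟨(‖K z.1 - b‖ + ‖c + K.adjoint z.2‖) * (r / cLow K τ σ), ?_⟩
    rintro _ ⟨ζ, ⟨-, -, hζ⟩, rfl⟩
    show gap K c b z ζ ≤ _
    rw [gap_eq_inner_sub]
    have hE : ‖WithLp.toLp 2 (ζ - z)‖ ≤ r / cLow K τ σ := by
      rw [le_div_iff₀ hcL, mul_comm]
      exact (cLow_mul_le_normM K hτ hσ hK.le (ζ - z)).trans hζ
    have h1 : ‖(ζ - z).2‖ ≤ ‖WithLp.toLp 2 (ζ - z)‖ := by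
      have := WithLp.norm_snd_le (x := WithLp.toLp 2 (ζ - z)); simpa using this
    have h2 : ‖(ζ - z).1‖ ≤ ‖WithLp.toLp 2 (ζ - z)‖ := by
      have := WithLp.norm_fst_le (x := WithLp.toLp 2 (ζ - z)); simpa using this
    have i1 : ⟪K z.1 - b, (ζ - z).2⟫ ≤ ‖K z.1 - b‖ * ‖(ζ - z).2‖ := real_inner_le_norm _ _
    have i2 : -⟪c + K.adjoint z.2, (ζ - z).1⟫ ≤ ‖c + K.adjoint z.2‖ * ‖(ζ - z).1‖ := by
      rw [← inner_neg_right]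
      exact (real_inner_le_norm _ _).trans (by rw [norm_neg])
    nlinarith [norm_nonneg (K z.1 - b), norm_nonneg (c + K.adjoint z.2), h1, h2, hE,
      norm_nonneg (ζ - z).1, norm_nonneg (ζ - z).2]
  have hz0 : gap K c b z z ∈ S := ⟨z, ⟨hz, Set.mem_univ _, by rw [sub_self, normM_zero]; exact hr.le⟩, rfl⟩
  have hρ0 : 0 ≤ rho K (orthant ιx) Set.univ c b τ σ r z := by
    unfold rho
    refine mul_nonneg (inv_nonneg.mpr hr.le) ?_
    have h := le_csSup hbdd hz0
    rwa [gap_self] at h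
  have hnz : 0 ≤ normM K τ σ z := normM_nonneg K τ σ z
  -- the gap along the shrink `ζ = z + (−s) • z`
  have hgap : ∀ s : ℝ, gap K c b z (z + (-s) • z) = s * G := by
    intro s
    rw [gap_add_eq, hG]
    simp only [Prod.smul_snd, Prod.smul_fst, inner_smul_right, inner_sub_left, inner_add_left,
      ContinuousLinearMap.adjoint_inner_left]
    rw [real_inner_comm (K z.1) z.2]
    ring
  have hfeas : ∀ s : ℝ, 0 ≤ s → s ≤ 1 → (z + (-s) • z).1 ∈ orthant ιx := by
    intro s hs0 hs1 i
    have e : (z + (-s) • z).1 i = (1 - s) * z.1 i := by simp; ring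
    rw [e]
    exact mul_nonneg (by linarith) (hz i)
  -- if `G ≤ 0` there is nothing to prove
  rcases le_or_gt G 0 with hG0 | hGpos
  · rw [max_eq_right hG0]
    exact mul_nonneg (by positivity) hρ0
  rw [max_eq_left hGpos.le]
  rcases le_or_gt (normM K τ σ z) r with hsmall | hlarge
  · -- `‖z‖_M ≤ r`: shrink all the way to `0` (`s = 1`): `G ≤ r ρ`
    have hmem : gap K c b z (z + (-(1 : ℝ)) • z) ∈ S := by
      refine ⟨z + (-(1 : ℝ)) • z, ⟨hfeas 1 zero_le_one le_rfl, Set.mem_univ _, ?_⟩, rfl⟩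
      rw [add_sub_cancel_left, normM_smul]
      simpa using hsmall
    have h := le_csSup hbdd hmem
    rw [hgap, one_mul] at h
    have h' : G ≤ r * rho K (orthant ιx) Set.univ c b τ σ r z := by
      unfold rho; rw [← mul_assoc, mul_inv_cancel₀ hr.ne', one_mul]; exact h
    nlinarith [h', hρ0, hnz]
  · -- `‖z‖_M > r`: shrink by `s = r/‖z‖_M`: `G ≤ ‖z‖_M ρ`
    have hzpos : 0 < normM K τ σ z := hr.trans hlarge
    set s := r / normM K τ σ z with hs
    have hs0 : 0 < s := div_pos hr hzpos
    have hs1 : s ≤ 1 := (div_le_one hzpos).mpr hlarge.le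
    have hmem : gap K c b z (z + (-s) • z) ∈ S := by
      refine ⟨z + (-s) • z, ⟨hfeas s hs0.le hs1, Set.mem_univ _, ?_⟩, rfl⟩
      rw [add_sub_cancel_left, normM_smul, abs_neg, abs_of_pos hs0, hs, div_mul_cancel₀ r hzpos.ne']
    have h := le_csSup hbdd hmem
    rw [hgap] at h
    -- `s G ≤ r ρ` ⇒ `G ≤ ‖z‖_M ρ`
    have h' : s * G ≤ r * rho K (orthant ιx) Set.univ c b τ σ r z := by
      unfold rho; rw [← mul_assoc, mul_inv_cancel₀ hr.ne', one_mul]; exact h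
    have h'' : G ≤ normM K τ σ z * rho K (orthant ιx) Set.univ c b τ σ r z := by
      have e : s * G = r * (G / normM K τ σ z) := by rw [hs]; field_simp
      rw [e] at h'
      have := le_of_mul_le_mul_left h' hr
      rwa [div_le_iff₀ hzpos, mul_comm] at this
    nlinarith [h'', hρ0, hr]

/-! ### Hoffman's residual of the KKT system at a feasible point -/

/-- `Σ_i v_i ≤ √|ι| · ‖v‖₂` for a coordinatewise nonnegative vector. [folklore: Cauchy–Schwarz] -/
private theorem sum_le_sqrt_card_mul_norm {ι : Type*} [Fintype ι] (v : EuclideanSpace ℝ ι)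
    (hv : ∀ i, 0 ≤ v i) : ∑ i, v i ≤ Real.sqrt (Fintype.card ι) * ‖v‖ := by
  have h1 : (∑ i, v i) ^ 2 ≤ Fintype.card ι * ‖v‖ ^ 2 := by
    rw [EuclideanSpace.real_norm_sq_eq]
    have := sq_sum_le_card_mul_sum_sq (s := Finset.univ) (f := fun i => v i)
    simpa using this
  have h0 : 0 ≤ ∑ i, v i := Finset.sum_nonneg fun i _ => hv i
  have h2 : (∑ i, v i) ^ 2 ≤ (Real.sqrt (Fintype.card ι) * ‖v‖) ^ 2 := by
    rw [mul_pow, Real.sq_sqrt (by positivity)]; exact h1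
  have h3 := Real.sqrt_le_sqrt h2
  rwa [Real.sqrt_sq h0, Real.sqrt_sq (by positivity)] at h3

/-- **The Hoffman residual of the KKT system at a feasible point is controlled by the normalized
duality gap** ([ApplegateEtAl2022, Lemma 4] in the `M`-geometry, `ℓ¹` residual): for `x ≥ 0`,
`Σ_rows (⟨a_ρ, z⟩ − h_ρ)₊ = Σ_j |(Kx − b)_j| + Σ_i (−(c + K*y)_i)₊ + (⟨c,x⟩ + ⟨b,y⟩)₊
 ≤ ((√|ιx| + √|ιy|) c↑ + r + ‖z‖_M) · ρ_r(z)`. [cite: ApplegateEtAl2022, Lemma 4] -/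
theorem kkt_residual_sum_le (K : EuclideanSpace ℝ ιx →L[ℝ] EuclideanSpace ℝ ιy)
    (c : EuclideanSpace ℝ ιx) (b : EuclideanSpace ℝ ιy) {τ σ : ℝ} (hτ : 0 < τ) (hσ : 0 < σ)
    (hK : τ * σ * ‖K‖ ^ 2 < 1) {z : EuclideanSpace ℝ ιx × EuclideanSpace ℝ ιy}
    (hz : z.1 ∈ orthant ιx) {r : ℝ} (hr : 0 < r) :
    ∑ ρ, HoffmanErrorBound.residual (kktNormal K c b) (kktRhs c b) (WithLp.toLp 2 z) ρ ≤
      ((Real.sqrt (Fintype.card ιx) + Real.sqrt (Fintype.card ιy)) * cUp K τ σ + r +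
        normM K τ σ z) * rho K (orthant ιx) Set.univ c b τ σ r z := by
  set ρr := rho K (orthant ιx) Set.univ c b τ σ r z with hρr
  set gx := c + K.adjoint z.2 with hgx
  set gy := K z.1 - b with hgy
  set nd := ‖WithLp.toLp 2 (negPart gx, gy)‖ with hnd
  have hnd_le : nd ≤ cUp K τ σ * ρr := norm_infeas_le K c b hτ hσ hK hz hr
  have hG := dualityGap_le K c b hτ hσ hK hz hr
  have hcU := cUp_nonneg K τ σ
  have hρ0 : 0 ≤ ρr := by
    by_contra hneg
    push Not at hneg
    have hpos : 0 < r + normM K τ σ z := add_pos_of_pos_of_nonneg hr (normM_nonneg K τ σ z)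
    have h1 : (r + normM K τ σ z) * ρr < 0 := mul_neg_of_pos_of_neg hpos hneg
    have h2 : 0 ≤ (r + normM K τ σ z) * ρr := (le_max_right _ _).trans hG
    linarith
  -- the component norms are below `nd`
  have hgy_le : ‖gy‖ ≤ nd := by
    have := WithLp.norm_snd_le (x := WithLp.toLp 2 (negPart gx, gy)); simpa using this
  have hneg_le : ‖negPart gx‖ ≤ nd := by
    have := WithLp.norm_fst_le (x := WithLp.toLp 2 (negPart gx, gy)); simpa using this
  -- split the sum over the row families
  rw [Fintype.sum_sum_type, Fintype.sum_sum_type, Fintype.sum_sum_type, Fintype.sum_sum_type]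
  -- (1) sign rows vanish
  have h1 : ∑ i : ιx, HoffmanErrorBound.residual (kktNormal K c b) (kktRhs c b) (WithLp.toLp 2 z) (Sum.inl i) = 0 := by
    refine Finset.sum_eq_zero fun i _ => ?_
    unfold HoffmanErrorBound.residual
    rw [inner_kktNormal]
    simp only [kktRhs, sub_zero]
    exact max_eq_right (by linarith [hz i])
  -- (2) equality rows: `(g_j)₊ + (−g_j)₊ = |g_j|`
  have h2 : ∑ j : ιy, HoffmanErrorBound.residual (kktNormal K c b) (kktRhs c b) (WithLp.toLp 2 z)
        (Sum.inr (Sum.inl (Sum.inl j))) +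
      ∑ j : ιy, HoffmanErrorBound.residual (kktNormal K c b) (kktRhs c b) (WithLp.toLp 2 z)
        (Sum.inr (Sum.inl (Sum.inr j))) = ∑ j, |gy j| := by
    rw [← Finset.sum_add_distrib]
    refine Finset.sum_congr rfl fun j _ => ?_
    unfold HoffmanErrorBound.residual
    rw [inner_kktNormal, inner_kktNormal]
    simp only [kktRhs, hgy]
    have e : (K z.1 - b) j = (K z.1) j - b j := by simp
    rw [e]
    rcases le_or_gt 0 ((K z.1) j - b j) with h | h
    · rw [max_eq_left h, max_eq_right (by linarith), abs_of_nonneg h]; ring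
    · rw [max_eq_right h.le, max_eq_left (by linarith), abs_of_neg h]; ring
  -- (3) dual rows: `(−g_i)₊`
  have h3 : ∑ i : ιx, HoffmanErrorBound.residual (kktNormal K c b) (kktRhs c b) (WithLp.toLp 2 z)
      (Sum.inr (Sum.inr (Sum.inl i))) = ∑ i, negPart gx i := by
    refine Finset.sum_congr rfl fun i _ => ?_
    unfold HoffmanErrorBound.residual
    rw [inner_kktNormal, negPart_apply]
    simp only [kktRhs, hgx]
    have e : (c + K.adjoint z.2) i = c i + (K.adjoint z.2) i := by simp
    rw [e]
    congr 1
    ring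
  -- (4) the gap row
  have h4 : ∑ u : Unit, HoffmanErrorBound.residual (kktNormal K c b) (kktRhs c b) (WithLp.toLp 2 z)
      (Sum.inr (Sum.inr (Sum.inr u))) = max (⟪c, z.1⟫ + ⟪b, z.2⟫) 0 := by
    rw [Fintype.sum_unique]
    unfold HoffmanErrorBound.residual
    rw [inner_kktNormal]
    simp [kktRhs]
  rw [h1, h3, h4, zero_add, ← add_assoc, h2]
  -- Cauchy–Schwarz on the two coordinate sums
  have hs2 : ∑ j, |gy j| ≤ Real.sqrt (Fintype.card ιy) * ‖gy‖ := by
    have h := sum_le_sqrt_card_mul_norm (WithLp.toLp 2 (fun j => |gy j|) : EuclideanSpace ℝ ιy)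
      (fun j => by simp)
    have e : ‖(WithLp.toLp 2 (fun j => |gy j|) : EuclideanSpace ℝ ιy)‖ = ‖gy‖ := by
      rw [EuclideanSpace.norm_eq, EuclideanSpace.norm_eq]
      simp
    simpa [e] using h
  have hs3 : ∑ i, negPart gx i ≤ Real.sqrt (Fintype.card ιx) * ‖negPart gx‖ :=
    sum_le_sqrt_card_mul_norm _ (negPart_nonneg gx)
  have hsx : 0 ≤ Real.sqrt (Fintype.card ιx) := Real.sqrt_nonneg _
  have hsy : 0 ≤ Real.sqrt (Fintype.card ιy) := Real.sqrt_nonneg _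
  nlinarith [hs2, hs3, hG, hnd_le, hgy_le, hneg_le, hsx, hsy, hcU, hρ0,
    mul_nonneg hsx hcU, mul_nonneg hsy hcU]

/-! ### LP is sharp on `M`-balls (Lemma 4/5 in the `M`-geometry) and restarted PDHG on LP converges linearly -/

omit [DecidableEq ιx] [DecidableEq ιy] in
/-- The normalized duality gap of the LP saddle is nonnegative at feasible points (test point
`ẑ = z`, or (eq:lp-3) with the positive part). [cite: ApplegateEtAl2022, Lemma 4 (proof, (eq:lp-3))] -/
theorem rho_lp_nonneg (K : EuclideanSpace ℝ ιx →L[ℝ] EuclideanSpace ℝ ιy)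
    (c : EuclideanSpace ℝ ιx) (b : EuclideanSpace ℝ ιy) {τ σ : ℝ} (hτ : 0 < τ) (hσ : 0 < σ)
    (hK : τ * σ * ‖K‖ ^ 2 < 1) {z : EuclideanSpace ℝ ιx × EuclideanSpace ℝ ιy}
    (hz : z.1 ∈ orthant ιx) {r : ℝ} (hr : 0 < r) :
    0 ≤ rho K (orthant ιx) Set.univ c b τ σ r z := by
  have hG := dualityGap_le K c b hτ hσ hK hz hr
  by_contra hneg
  push Not at hneg
  have hpos : 0 < r + normM K τ σ z := add_pos_of_pos_of_nonneg hr (normM_nonneg K τ σ z)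
  have h1 : (r + normM K τ σ z) * rho K (orthant ιx) Set.univ c b τ σ r z < 0 :=
    mul_neg_of_pos_of_neg hpos hneg
  have h2 : 0 ≤ (r + normM K τ σ z) * rho K (orthant ιx) Set.univ c b τ σ r z :=
    (le_max_right _ _).trans hG
  linarith

omit [DecidableEq ιx] [DecidableEq ιy] in
/-- **Linear programs are sharp** ([ApplegateEtAl2022, Lemma 5 with Lemma 4], stated in the
`M`-geometry of `RestartedPDHG.IsSharpOn` as licensed by [ApplegateEtAl2022, §3, remark after
Definition 1: "for any other norms the sharpness condition still holds (up to a constant)"]): for the LP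
Lagrangian `L(x, y) = ⟨c, x⟩ + ⟨Kx, y⟩ − ⟨b, y⟩` on `x ≥ 0`, `y` free, with a primal–dual solution and
step sizes `τσ‖K‖² < 1`, on every `M`-ball `W_R(w) ∩ (ℝⁿ₊ × ℝᵐ)` there is `α > 0` with
`α · dist_M(z, Z*) ≤ ρ_r(z)` for all `z` in the ball and all `r ∈ (0, diam_M]`. The constant is
`α = 1 / (c↑ · H · ((√n + √m) c↑ + 3|R| + ‖w‖_M) + 1)` with `H` the Hoffman constant of the KKT system
`kktNormal`. Proof as printed: Hoffman's bound for the KKT polyhedron (`HoffmanErrorBound.hoffman`,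
[Hoffman1952]) + the two test points of Lemma 4 (`kkt_residual_sum_le`) + norm comparison
(`infDistM_le_cUp_mul`). [cite: ApplegateEtAl2022, Lemma 5 (with Lemma 4); Hoffman1952, Theorem §2] -/
theorem isSharpOn_lp (K : EuclideanSpace ℝ ιx →L[ℝ] EuclideanSpace ℝ ιy)
    (c : EuclideanSpace ℝ ιx) (b : EuclideanSpace ℝ ιy) {τ σ : ℝ} (hτ : 0 < τ) (hσ : 0 < σ)
    (hK : τ * σ * ‖K‖ ^ 2 < 1) (hZ : (saddleSet K (orthant ιx) Set.univ c b).Nonempty)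
    (w : EuclideanSpace ℝ ιx × EuclideanSpace ℝ ιy) (R : ℝ) :
    ∃ α : ℝ, 0 < α ∧
      IsSharpOn K (orthant ιx) Set.univ c b τ σ (ballM K (orthant ιx) Set.univ τ σ w R) α := by
  classical
  obtain ⟨H, hH0, hH⟩ := hoffman (kktNormal K c b)
  have hPne : (polyhedron (kktNormal K c b) (kktRhs c b)).Nonempty := by
    rw [polyhedron_kkt_eq]; exact hZ.image _
  set Zs := saddleSet K (orthant ιx) Set.univ c b with hZs
  set cU := cUp K τ σ with hcUdef
  set B := (Real.sqrt (Fintype.card ιx) + Real.sqrt (Fintype.card ιy)) * cU + 3 * |R| +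
    normM K τ σ w with hB
  have hcU : 0 ≤ cU := cUp_nonneg K τ σ
  have hB0 : 0 ≤ B := by
    have := normM_nonneg K τ σ w
    positivity
  have hD0 : 0 < cU * H * B + 1 := by positivity
  refine ⟨(cU * H * B + 1)⁻¹, inv_pos.mpr hD0, ?_⟩
  intro z hz r hr hrdiam
  rw [mem_ballM_iff] at hz
  obtain ⟨hz1, -, hzw⟩ := hz
  have hR : 0 ≤ R := (normM_nonneg K τ σ _).trans hzw
  have hr2R : r ≤ 2 * R := hrdiam.trans (diamM_ballM_le K _ _ hτ hσ hK.le w hR)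
  have hzn : normM K τ σ z ≤ R + normM K τ σ w := by
    have h := normM_add_le K hτ hσ hK.le (z - w) w
    rw [sub_add_cancel] at h
    linarith
  have hρ0 := rho_lp_nonneg K c b hτ hσ hK hz1 hr
  set ρr := rho K (orthant ιx) Set.univ c b τ σ r z with hρr
  -- Hoffman at the point `z` for the KKT polyhedron
  obtain ⟨x₀, hx₀P, hx₀⟩ := hH (kktRhs c b) hPne (WithLp.toLp 2 z)
  have hx₀Z : WithLp.ofLp x₀ ∈ Zs := by
    rw [hZs, ← mem_polyhedron_kkt_iff, WithLp.toLp_ofLp]; exact hx₀P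
  -- distance in the `M`-seminorm ≤ c↑ · Euclidean distance ≤ c↑ · H · (KKT residual)
  have hdist : infDistM K τ σ z Zs ≤ cU * (H * ∑ ρ, HoffmanErrorBound.residual (kktNormal K c b)
      (kktRhs c b) (WithLp.toLp 2 z) ρ) := by
    have h := infDistM_le_cUp_mul K hτ hσ z hx₀Z
    rw [WithLp.toLp_ofLp] at h
    exact h.trans (mul_le_mul_of_nonneg_left hx₀ hcU)
  have hV := kkt_residual_sum_le K c b hτ hσ hK hz1 hr
  have hfac : (Real.sqrt (Fintype.card ιx) + Real.sqrt (Fintype.card ιy)) * cU + r +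
      normM K τ σ z ≤ B := by
    rw [hB]; linarith [le_abs_self R]
  have hmain : infDistM K τ σ z Zs ≤ (cU * H * B + 1) * ρr := by
    have h1 : infDistM K τ σ z Zs ≤ cU * H * (B * ρr) := by
      calc infDistM K τ σ z Zs ≤ cU * (H * ∑ ρ, HoffmanErrorBound.residual (kktNormal K c b)
            (kktRhs c b) (WithLp.toLp 2 z) ρ) := hdist
        _ ≤ cU * (H * (B * ρr)) := by
            refine mul_le_mul_of_nonneg_left (mul_le_mul_of_nonneg_left ?_ hH0) hcU
            exact hV.trans (mul_le_mul_of_nonneg_right hfac hρ0)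
        _ = cU * H * (B * ρr) := by ring
    nlinarith [mul_nonneg (mul_nonneg hcU hH0) hB0]
  rw [inv_mul_le_iff₀ hD0]
  exact hmain

omit [DecidableEq ιx] [DecidableEq ιy] in
/-- **Restarted PDHG converges linearly on linear programs** ([ApplegateEtAl2022, Theorem 1 with
Lemma 5 / Corollary for LP, §3.3 and §4]): for the LP saddle on `x ≥ 0`, `y` free, with a primal–dual
solution, PDHG steps `τ, σ > 0` with `τσ‖K‖² < 1` (resolvents `jA`, `jB` of the shifted normal-cone
operators, i.e. `x ↦ proj_{ℝⁿ₊}(x − τ(c + ·))`-type prox maps), a feasible start `z₀` and any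
`β ∈ (0, 1)`, there is `α > 0` (the sharpness constant of `isSharpOn_lp` on the ball
`W_{2 dist_M(z₀, Z*)/(1−β)}(z₀)`) such that fixed-frequency restarts of length `t` with `4/(αt) ≤ β`
contract the `M`-distance to the solution set by `β` per restart:
`dist_M(z^{n,0}, Z*) ≤ βⁿ dist_M(z^{0,0}, Z*)`.
[cite: ApplegateEtAl2022, Theorem 1 with Lemma 5 (LP case, §3.3–§4)] -/
theorem lp_restartedPDHG_linear (K : EuclideanSpace ℝ ιx →L[ℝ] EuclideanSpace ℝ ιy)
    (c : EuclideanSpace ℝ ιx) (b : EuclideanSpace ℝ ιy) {τ σ : ℝ} (hτ : 0 < τ) (hσ : 0 < σ)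
    (hK : τ * σ * ‖K‖ ^ 2 < 1) {jA : EuclideanSpace ℝ ιx → EuclideanSpace ℝ ιx}
    {jB : EuclideanSpace ℝ ιy → EuclideanSpace ℝ ιy}
    (hjA : IsResolventMap τ (shiftOp c (normalCone (orthant ιx))) jA)
    (hjB : IsResolventMap σ (shiftOp b (normalCone (Set.univ : Set (EuclideanSpace ℝ ιy)))) jB)
    (hZ : (saddleSet K (orthant ιx) Set.univ c b).Nonempty) {β : ℝ} (hβ0 : 0 ≤ β) (hβ1 : β < 1)
    {z₀ : EuclideanSpace ℝ ιx × EuclideanSpace ℝ ιy} (hz₀ : z₀.1 ∈ orthant ιx) :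
    ∃ α : ℝ, 0 < α ∧ ∀ t : ℕ, t ≠ 0 → 4 / (α * t) ≤ β → ∀ n : ℕ,
      infDistM K τ σ ((avgPDHG K τ σ jA jB t)^[n] z₀) (saddleSet K (orthant ιx) Set.univ c b) ≤
        β ^ n * infDistM K τ σ z₀ (saddleSet K (orthant ιx) Set.univ c b) := by
  obtain ⟨α, hα, hsharp⟩ := isSharpOn_lp K c b hτ hσ hK hZ z₀
    (2 / (1 - β) * infDistM K τ σ z₀ (saddleSet K (orthant ιx) Set.univ c b))
  exact ⟨α, hα, fun t ht htstar n => infDistM_iterate_avgPDHG_le_pow K convex_orthant convex_univ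
    c b hτ hσ hK.le hjA hjB hZ ht hα hβ0 hβ1 htstar ⟨hz₀, Set.mem_univ _⟩ hsharp n⟩

/-! ### Unconstrained bilinear saddles are sharp ([ApplegateEtAl2022, §3.2, Lemma 3], with an
existential constant obtained from Hoffman's bound in place of the printed `σ_min⁺(A)`) -/

omit [DecidableEq ιx] [DecidableEq ιy] in
/-- The gap set over an `M`-ball is bounded above (when `τσ‖K‖² < 1` the `M`-seminorm dominates the
Euclidean norm, `cLow_mul_le_normM`, and the gap is bilinear, `gap_eq_inner_sub`).
[cite: ApplegateEtAl2022, §3.2 (17) with the display after the §3 remark (‖·‖_M ≍ ‖·‖₂)] -/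
theorem bddAbove_gap_ballM (K : EuclideanSpace ℝ ιx →L[ℝ] EuclideanSpace ℝ ιy)
    (C : Set (EuclideanSpace ℝ ιx)) (D : Set (EuclideanSpace ℝ ιy))
    (c : EuclideanSpace ℝ ιx) (b : EuclideanSpace ℝ ιy) {τ σ : ℝ} (hτ : 0 < τ) (hσ : 0 < σ)
    (hK : τ * σ * ‖K‖ ^ 2 < 1) (z : EuclideanSpace ℝ ιx × EuclideanSpace ℝ ιy) (r : ℝ) :
    BddAbove ((fun ζ => gap K c b z ζ) ''
      {ζ : EuclideanSpace ℝ ιx × EuclideanSpace ℝ ιy |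
        ζ.1 ∈ C ∧ ζ.2 ∈ D ∧ normM K τ σ (ζ - z) ≤ r}) := by
  have hcL := cLow_pos K hτ hσ hK
  refine ⟨(‖K z.1 - b‖ + ‖c + K.adjoint z.2‖) * (r / cLow K τ σ), ?_⟩
  rintro _ ⟨ζ, ⟨-, -, hζ⟩, rfl⟩
  show gap K c b z ζ ≤ _
  rw [gap_eq_inner_sub]
  have hE : ‖WithLp.toLp 2 (ζ - z)‖ ≤ r / cLow K τ σ := by
    rw [le_div_iff₀ hcL, mul_comm]
    exact (cLow_mul_le_normM K hτ hσ hK.le (ζ - z)).trans hζ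
  have h1 : ‖(ζ - z).2‖ ≤ ‖WithLp.toLp 2 (ζ - z)‖ := by
    have := WithLp.norm_snd_le (x := WithLp.toLp 2 (ζ - z)); simpa using this
  have h2 : ‖(ζ - z).1‖ ≤ ‖WithLp.toLp 2 (ζ - z)‖ := by
    have := WithLp.norm_fst_le (x := WithLp.toLp 2 (ζ - z)); simpa using this
  have i1 : ⟪K z.1 - b, (ζ - z).2⟫ ≤ ‖K z.1 - b‖ * ‖(ζ - z).2‖ := real_inner_le_norm _ _
  have i2 : -⟪c + K.adjoint z.2, (ζ - z).1⟫ ≤ ‖c + K.adjoint z.2‖ * ‖(ζ - z).1‖ := by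
    rw [← inner_neg_right]
    exact (real_inner_le_norm _ _).trans (by rw [norm_neg])
  nlinarith [norm_nonneg (K z.1 - b), norm_nonneg (c + K.adjoint z.2), h1, h2, hE,
    norm_nonneg (ζ - z).1, norm_nonneg (ζ - z).2]

omit [DecidableEq ιx] [DecidableEq ιy] in
/-- The normalized duality gap is nonnegative at feasible points (test point `ẑ = z`).
[cite: ApplegateEtAl2022, §2 (4) (ρ_r ≥ 0 at feasible z)] -/
theorem rho_nonneg_of_mem (K : EuclideanSpace ℝ ιx →L[ℝ] EuclideanSpace ℝ ιy)
    {C : Set (EuclideanSpace ℝ ιx)} {D : Set (EuclideanSpace ℝ ιy)}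
    (c : EuclideanSpace ℝ ιx) (b : EuclideanSpace ℝ ιy) {τ σ : ℝ} (hτ : 0 < τ) (hσ : 0 < σ)
    (hK : τ * σ * ‖K‖ ^ 2 < 1) {z : EuclideanSpace ℝ ιx × EuclideanSpace ℝ ιy} (hz1 : z.1 ∈ C)
    (hz2 : z.2 ∈ D) {r : ℝ} (hr : 0 < r) : 0 ≤ rho K C D c b τ σ r z := by
  unfold rho
  refine mul_nonneg (inv_nonneg.mpr hr.le) ?_
  have h : gap K c b z z ≤ _ := le_csSup (bddAbove_gap_ballM K C D c b hτ hσ hK z r)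
    ⟨z, ⟨hz1, hz2, by rw [sub_self, normM_zero]; exact hr.le⟩, rfl⟩
  rwa [gap_self] at h

omit [DecidableEq ιx] [DecidableEq ιy] in
/-- **Saddle points of the unconstrained bilinear Lagrangian** `L = ⟨c, x⟩ + ⟨Kx, y⟩ − ⟨b, y⟩` on
`ℝⁿ × ℝᵐ`: `Z* = {z : F(z) = 0} = {Kx = b, c + K*y = 0}`.
[cite: ApplegateEtAl2022, Lemma 3 (proof: Z* = {z ∈ Z | F(z) = 0} = {Hz = h})] -/
theorem mem_saddleSet_bilinear_iff (K : EuclideanSpace ℝ ιx →L[ℝ] EuclideanSpace ℝ ιy)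
    (c : EuclideanSpace ℝ ιx) (b : EuclideanSpace ℝ ιy)
    (z : EuclideanSpace ℝ ιx × EuclideanSpace ℝ ιy) :
    z ∈ saddleSet K Set.univ Set.univ c b ↔ K z.1 = b ∧ c + K.adjoint z.2 = 0 := by
  rw [mem_saddleSet_iff]
  constructor
  · rintro ⟨-, -, hmin, hmax⟩
    have hres : K z.1 - b = 0 := by
      have h := hmax (z.2 + (K z.1 - b)) (Set.mem_univ _)
      rw [conicL_eq_inner_primalRes, conicL_eq_inner_primalRes, inner_add_right,
        real_inner_self_eq_norm_sq] at h
      have h0 : ‖K z.1 - b‖ ^ 2 ≤ 0 := by linarith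
      have h1 : ‖K z.1 - b‖ = 0 := by nlinarith [norm_nonneg (K z.1 - b)]
      exact norm_eq_zero.mp h1
    have hslack : c + K.adjoint z.2 = 0 := by
      have h := hmin (z.1 - (c + K.adjoint z.2)) (Set.mem_univ _)
      rw [conicL_eq_inner_dualSlack, conicL_eq_inner_dualSlack, inner_sub_right,
        real_inner_self_eq_norm_sq] at h
      have h0 : ‖c + K.adjoint z.2‖ ^ 2 ≤ 0 := by linarith
      have h1 : ‖c + K.adjoint z.2‖ = 0 := by nlinarith [norm_nonneg (c + K.adjoint z.2)]
      exact norm_eq_zero.mp h1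
    exact ⟨sub_eq_zero.mp hres, hslack⟩
  · rintro ⟨hKb, hslack⟩
    have hres : K z.1 - b = 0 := sub_eq_zero.mpr hKb
    refine ⟨Set.mem_univ _, Set.mem_univ _, fun x _ => ?_, fun y _ => ?_⟩
    · rw [conicL_eq_inner_dualSlack, conicL_eq_inner_dualSlack, hslack, inner_zero_left,
        inner_zero_left]
    · rw [conicL_eq_inner_primalRes, conicL_eq_inner_primalRes, hres, inner_zero_left,
        inner_zero_left]

/-- Rows of the linear system `Hz = h` of [ApplegateEtAl2022, Lemma 3] written as inequalities:
`(Kx)_j ≤ b_j`, `−(Kx)_j ≤ −b_j`, `−(K*y)_i ≤ c_i`, `(K*y)_i ≤ −c_i`.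
[cite: ApplegateEtAl2022, Lemma 3 (H and h)] -/
abbrev BilRow (ιx ιy : Type*) := (ιy ⊕ ιy) ⊕ (ιx ⊕ ιx)

/-- Normals of the system `Hz = h` in `Z = X × Y`. [cite: ApplegateEtAl2022, Lemma 3 (H and h)] -/
noncomputable def bilNormal (K : EuclideanSpace ℝ ιx →L[ℝ] EuclideanSpace ℝ ιy) :
    BilRow ιx ιy → WithLp 2 (EuclideanSpace ℝ ιx × EuclideanSpace ℝ ιy)
  | Sum.inl (Sum.inl j) => WithLp.toLp 2 (K.adjoint (EuclideanSpace.single j (1 : ℝ)), 0)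
  | Sum.inl (Sum.inr j) => WithLp.toLp 2 (-K.adjoint (EuclideanSpace.single j (1 : ℝ)), 0)
  | Sum.inr (Sum.inl i) => WithLp.toLp 2 (0, -K (EuclideanSpace.single i (1 : ℝ)))
  | Sum.inr (Sum.inr i) => WithLp.toLp 2 (0, K (EuclideanSpace.single i (1 : ℝ)))

/-- Right-hand sides of the system `Hz = h`. [cite: ApplegateEtAl2022, Lemma 3 (H and h)] -/
def bilRhs (c : EuclideanSpace ℝ ιx) (b : EuclideanSpace ℝ ιy) : BilRow ιx ιy → ℝ
  | Sum.inl (Sum.inl j) => b j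
  | Sum.inl (Sum.inr j) => -b j
  | Sum.inr (Sum.inl i) => c i
  | Sum.inr (Sum.inr i) => -c i

/-- The rows evaluated at `z = (x, y)`. [cite: ApplegateEtAl2022, Lemma 3 (H and h)] -/
theorem inner_bilNormal (K : EuclideanSpace ℝ ιx →L[ℝ] EuclideanSpace ℝ ιy)
    (z : EuclideanSpace ℝ ιx × EuclideanSpace ℝ ιy) (ρ : BilRow ιx ιy) :
    ⟪bilNormal K ρ, WithLp.toLp 2 z⟫ =
      match ρ with
      | Sum.inl (Sum.inl j) => (K z.1) j
      | Sum.inl (Sum.inr j) => -(K z.1) j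
      | Sum.inr (Sum.inl i) => -(K.adjoint z.2) i
      | Sum.inr (Sum.inr i) => (K.adjoint z.2) i := by
  rcases ρ with (j | j) | (i | i)
  · simp [bilNormal, WithLp.prod_inner_apply, ContinuousLinearMap.adjoint_inner_left,
      EuclideanSpace.inner_single_left]
  · simp [bilNormal, WithLp.prod_inner_apply, inner_neg_left, ContinuousLinearMap.adjoint_inner_left,
      EuclideanSpace.inner_single_left]
  · simp [bilNormal, WithLp.prod_inner_apply, inner_neg_left, ← ContinuousLinearMap.adjoint_inner_right,
      EuclideanSpace.inner_single_left]
  · simp [bilNormal, WithLp.prod_inner_apply, ← ContinuousLinearMap.adjoint_inner_right,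
      EuclideanSpace.inner_single_left]

/-- `Z*` of the bilinear problem is the polyhedron `{Hz = h}`.
[cite: ApplegateEtAl2022, Lemma 3 (Z* = {z | Hz = h})] -/
theorem mem_polyhedron_bil_iff (K : EuclideanSpace ℝ ιx →L[ℝ] EuclideanSpace ℝ ιy)
    (c : EuclideanSpace ℝ ιx) (b : EuclideanSpace ℝ ιy)
    (z : EuclideanSpace ℝ ιx × EuclideanSpace ℝ ιy) :
    WithLp.toLp 2 z ∈ polyhedron (bilNormal K) (bilRhs c b) ↔
      z ∈ saddleSet K Set.univ Set.univ c b := by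
  rw [mem_saddleSet_bilinear_iff, HoffmanErrorBound.mem_polyhedron_iff]
  constructor
  · intro h
    have h2 : ∀ j, (K z.1) j = b j := fun j => by
      have ha := h (Sum.inl (Sum.inl j))
      have hb := h (Sum.inl (Sum.inr j))
      rw [inner_bilNormal] at ha hb
      simp only [bilRhs] at ha hb
      linarith
    have h3 : ∀ i, c i + (K.adjoint z.2) i = 0 := fun i => by
      have ha := h (Sum.inr (Sum.inl i))
      have hb := h (Sum.inr (Sum.inr i))
      rw [inner_bilNormal] at ha hb
      simp only [bilRhs] at ha hb
      linarith
    exact ⟨PiLp.ext h2, PiLp.ext fun i => by simpa using h3 i⟩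
  · rintro ⟨h2, h3⟩ ρ
    have h3' : ∀ i, c i + (K.adjoint z.2) i = 0 := fun i => by
      have := congrArg (fun v : EuclideanSpace ℝ ιx => v i) h3
      simpa using this
    rw [inner_bilNormal]
    rcases ρ with (j | j) | (i | i)
    · simp [bilRhs, h2]
    · simp [bilRhs, h2]
    · simp only [bilRhs]; linarith [h3' i]
    · simp only [bilRhs]; linarith [h3' i]

/-- The polyhedron `{Hz = h}` is the image of `Z*`. [cite: ApplegateEtAl2022, Lemma 3 (Z* = {z | Hz = h})] -/
theorem polyhedron_bil_eq (K : EuclideanSpace ℝ ιx →L[ℝ] EuclideanSpace ℝ ιy)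
    (c : EuclideanSpace ℝ ιx) (b : EuclideanSpace ℝ ιy) :
    polyhedron (bilNormal K) (bilRhs c b) = (WithLp.toLp 2) '' saddleSet K Set.univ Set.univ c b := by
  ext w
  constructor
  · intro hw
    refine ⟨WithLp.ofLp w, ?_, rfl⟩
    rw [← mem_polyhedron_bil_iff]
    exact hw
  · rintro ⟨z, hz, rfl⟩
    exact (mem_polyhedron_bil_iff K c b z).mpr hz

omit [DecidableEq ιx] [DecidableEq ιy] in
/-- **`‖F(z)‖₂ ≤ c↑ · ρ_r(z)` for the unconstrained bilinear problem** ((eq:bilinear-1) in the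
`M`-geometry: `ρ_r(z) = ‖F(z)‖` in the Euclidean norm; here the test point `z + (r/‖F‖_M) F♭` with
`F♭ = (−(c + K*y), Kx − b)` gives the inequality with the comparison constant `c↑`).
[cite: ApplegateEtAl2022, Lemma 3 (proof, (eq:bilinear-1))] -/
theorem norm_F_le (K : EuclideanSpace ℝ ιx →L[ℝ] EuclideanSpace ℝ ιy)
    (c : EuclideanSpace ℝ ιx) (b : EuclideanSpace ℝ ιy) {τ σ : ℝ} (hτ : 0 < τ) (hσ : 0 < σ)
    (hK : τ * σ * ‖K‖ ^ 2 < 1) (z : EuclideanSpace ℝ ιx × EuclideanSpace ℝ ιy) {r : ℝ}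
    (hr : 0 < r) :
    ‖WithLp.toLp 2 (-(c + K.adjoint z.2), K z.1 - b)‖ ≤
      cUp K τ σ * rho K Set.univ Set.univ c b τ σ r z := by
  set d : EuclideanSpace ℝ ιx × EuclideanSpace ℝ ιy := (-(c + K.adjoint z.2), K z.1 - b) with hd
  set nd := ‖WithLp.toLp 2 d‖ with hnd
  have hnd0 : 0 ≤ nd := norm_nonneg _
  set S := (fun ζ => gap K c b z ζ) ''
    {ζ : EuclideanSpace ℝ ιx × EuclideanSpace ℝ ιy |
      ζ.1 ∈ (Set.univ : Set (EuclideanSpace ℝ ιx)) ∧ ζ.2 ∈ (Set.univ : Set (EuclideanSpace ℝ ιy)) ∧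
        normM K τ σ (ζ - z) ≤ r} with hS
  have hcL := cLow_pos K hτ hσ hK
  have hbdd : BddAbove S := bddAbove_gap_ballM K Set.univ Set.univ c b hτ hσ hK z r
  have hρ0 : 0 ≤ rho K Set.univ Set.univ c b τ σ r z :=
    rho_nonneg_of_mem K c b hτ hσ hK (Set.mem_univ z.1) (Set.mem_univ z.2) hr
  rcases hnd0.eq_or_lt with hnd00 | hndpos
  · rw [← hnd00]
    exact mul_nonneg (cUp_nonneg K τ σ) hρ0
  have hdM : 0 < normM K τ σ d :=
    lt_of_lt_of_le (mul_pos hcL hndpos) (cLow_mul_le_normM K hτ hσ hK.le d)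
  set s := r / normM K τ σ d with hs
  have hs0 : 0 < s := div_pos hr hdM
  have hmem : gap K c b z (z + s • d) ∈ S := by
    refine ⟨z + s • d, ⟨Set.mem_univ _, Set.mem_univ _, ?_⟩, rfl⟩
    rw [add_sub_cancel_left, normM_smul, abs_of_pos hs0, hs, div_mul_cancel₀ r hdM.ne']
  have hgap : gap K c b z (z + s • d) = s * nd ^ 2 := by
    rw [gap_add_eq]
    simp only [hd, Prod.smul_snd, Prod.smul_fst, inner_smul_right, inner_neg_right]
    rw [hnd, WithLp.prod_norm_sq_eq_of_L2]
    simp only [WithLp.toLp_fst, WithLp.toLp_snd, hd, norm_neg]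
    rw [real_inner_self_eq_norm_sq, real_inner_self_eq_norm_sq]
    ring
  have hle : s * nd ^ 2 ≤ r * rho K Set.univ Set.univ c b τ σ r z := by
    have h := le_csSup hbdd hmem
    rw [hgap] at h
    unfold rho
    rw [← mul_assoc, mul_inv_cancel₀ hr.ne', one_mul]
    exact h
  have hup : normM K τ σ d ≤ cUp K τ σ * nd := normM_le_cUp_mul K hτ hσ d
  have h1 : nd ^ 2 * r ≤ r * rho K Set.univ Set.univ c b τ σ r z * normM K τ σ d := by
    have := mul_le_mul_of_nonneg_right hle hdM.le
    rw [hs] at this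
    calc nd ^ 2 * r = r / normM K τ σ d * nd ^ 2 * normM K τ σ d := by
          field_simp
      _ ≤ r * rho K Set.univ Set.univ c b τ σ r z * normM K τ σ d := this
  have h2 : nd ^ 2 ≤ rho K Set.univ Set.univ c b τ σ r z * normM K τ σ d := by
    have : r * nd ^ 2 ≤ r * (rho K Set.univ Set.univ c b τ σ r z * normM K τ σ d) := by
      linarith
    exact le_of_mul_le_mul_left this hr
  have h3 : nd ^ 2 ≤ rho K Set.univ Set.univ c b τ σ r z * (cUp K τ σ * nd) :=
    h2.trans (mul_le_mul_of_nonneg_left hup hρ0)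
  have h4 : nd * nd ≤ nd * (cUp K τ σ * rho K Set.univ Set.univ c b τ σ r z) := by
    nlinarith
  exact le_of_mul_le_mul_left h4 hndpos

omit [DecidableEq ιx] in
/-- `Σ_j |g_j| ≤ √|ι| · ‖g‖₂` (Cauchy–Schwarz). [cite: ApplegateEtAl2022, Lemma 4 (proof, "the property of ℓ₂ norm")] -/
private theorem sum_abs_le_sqrt_card_mul_norm {ι : Type*} [Fintype ι] (g : EuclideanSpace ℝ ι) :
    ∑ j, |g j| ≤ Real.sqrt (Fintype.card ι) * ‖g‖ := by
  have h := sum_le_sqrt_card_mul_norm (WithLp.toLp 2 (fun j => |g j|) : EuclideanSpace ℝ ι)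
    (fun j => by simp)
  have e : ‖(WithLp.toLp 2 (fun j => |g j|) : EuclideanSpace ℝ ι)‖ = ‖g‖ := by
    rw [EuclideanSpace.norm_eq, EuclideanSpace.norm_eq]
    simp
  simpa [e] using h

/-- **The Hoffman residual of `Hz = h` is controlled by the normalized duality gap**
((eq:bilinear-2) in `ℓ¹` form): `Σ_j |(Kx − b)_j| + Σ_i |(c + K*y)_i| ≤ (√n + √m) c↑ ρ_r(z)`.
[cite: ApplegateEtAl2022, Lemma 3 (proof, (eq:bilinear-1)–(eq:bilinear-2))] -/
theorem bil_residual_sum_le (K : EuclideanSpace ℝ ιx →L[ℝ] EuclideanSpace ℝ ιy)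
    (c : EuclideanSpace ℝ ιx) (b : EuclideanSpace ℝ ιy) {τ σ : ℝ} (hτ : 0 < τ) (hσ : 0 < σ)
    (hK : τ * σ * ‖K‖ ^ 2 < 1) (z : EuclideanSpace ℝ ιx × EuclideanSpace ℝ ιy) {r : ℝ}
    (hr : 0 < r) :
    ∑ ρ, HoffmanErrorBound.residual (bilNormal K) (bilRhs c b) (WithLp.toLp 2 z) ρ ≤
      (Real.sqrt (Fintype.card ιx) + Real.sqrt (Fintype.card ιy)) * cUp K τ σ *
        rho K Set.univ Set.univ c b τ σ r z := by
  set ρr := rho K Set.univ Set.univ c b τ σ r z with hρr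
  set gx := c + K.adjoint z.2 with hgx
  set gy := K z.1 - b with hgy
  set nd := ‖WithLp.toLp 2 (-gx, gy)‖ with hnd
  have hnd_le : nd ≤ cUp K τ σ * ρr := norm_F_le K c b hτ hσ hK z hr
  have hρ0 : 0 ≤ ρr := rho_nonneg_of_mem K c b hτ hσ hK (Set.mem_univ z.1) (Set.mem_univ z.2) hr
  have hcU := cUp_nonneg K τ σ
  have hgy_le : ‖gy‖ ≤ nd := by
    have := WithLp.norm_snd_le (x := WithLp.toLp 2 (-gx, gy)); simpa using this
  have hgx_le : ‖gx‖ ≤ nd := by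
    have := WithLp.norm_fst_le (x := WithLp.toLp 2 (-gx, gy)); simpa [norm_neg] using this
  rw [Fintype.sum_sum_type, Fintype.sum_sum_type, Fintype.sum_sum_type]
  -- equality rows: `(g_j)₊ + (−g_j)₊ = |g_j|`
  have h2 : ∑ j : ιy, HoffmanErrorBound.residual (bilNormal K) (bilRhs c b) (WithLp.toLp 2 z)
        (Sum.inl (Sum.inl j)) +
      ∑ j : ιy, HoffmanErrorBound.residual (bilNormal K) (bilRhs c b) (WithLp.toLp 2 z)
        (Sum.inl (Sum.inr j)) = ∑ j, |gy j| := by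
    rw [← Finset.sum_add_distrib]
    refine Finset.sum_congr rfl fun j _ => ?_
    unfold HoffmanErrorBound.residual
    rw [inner_bilNormal, inner_bilNormal]
    simp only [bilRhs, hgy]
    have e : (K z.1 - b) j = (K z.1) j - b j := by simp
    rw [e]
    rcases le_or_gt 0 ((K z.1) j - b j) with h | h
    · rw [max_eq_left h, max_eq_right (by linarith), abs_of_nonneg h]; ring
    · rw [max_eq_right h.le, max_eq_left (by linarith), abs_of_neg h]; ring
  -- dual rows: `(−g_i)₊ + (g_i)₊ = |g_i|`
  have h3 : ∑ i : ιx, HoffmanErrorBound.residual (bilNormal K) (bilRhs c b) (WithLp.toLp 2 z)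
        (Sum.inr (Sum.inl i)) +
      ∑ i : ιx, HoffmanErrorBound.residual (bilNormal K) (bilRhs c b) (WithLp.toLp 2 z)
        (Sum.inr (Sum.inr i)) = ∑ i, |gx i| := by
    rw [← Finset.sum_add_distrib]
    refine Finset.sum_congr rfl fun i _ => ?_
    unfold HoffmanErrorBound.residual
    rw [inner_bilNormal, inner_bilNormal]
    simp only [bilRhs, hgx]
    have e : (c + K.adjoint z.2) i = c i + (K.adjoint z.2) i := by simp
    rw [e]
    rcases le_or_gt 0 (c i + (K.adjoint z.2) i) with h | h
    · rw [max_eq_right (by linarith), max_eq_left (by linarith), abs_of_nonneg h]; ring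
    · rw [max_eq_left (by linarith), max_eq_right (by linarith), abs_of_neg h]; ring
  rw [h2, h3]
  have hs2 := sum_abs_le_sqrt_card_mul_norm gy
  have hs3 := sum_abs_le_sqrt_card_mul_norm gx
  have hsx : 0 ≤ Real.sqrt (Fintype.card ιx) := Real.sqrt_nonneg _
  have hsy : 0 ≤ Real.sqrt (Fintype.card ιy) := Real.sqrt_nonneg _
  nlinarith [hs2, hs3, hnd_le, hgy_le, hgx_le, hsx, hsy, hcU, hρ0,
    mul_nonneg hsx hcU, mul_nonneg hsy hcU]

omit [DecidableEq ιx] [DecidableEq ιy] in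
/-- **Unconstrained bilinear saddles are sharp — globally** ([ApplegateEtAl2022, Lemma 3] in the
`M`-geometry): if `L = ⟨c, x⟩ + ⟨Kx, y⟩ − ⟨b, y⟩` on `ℝⁿ × ℝᵐ` has a saddle point and `τσ‖K‖² < 1`,
there is ONE `α > 0` such that the problem is `α`-sharp on every set `S`:
`α dist_M(z, Z*) ≤ ρ_r(z)` for all `z`, `r > 0`. The printed constant is `σ_min⁺(A)` (Lemma 2); here
`α = 1/(c↑ H (√n + √m) c↑ + 1)` with `H` the Hoffman constant of `{Hz = h}` (`HoffmanErrorBound.hoffman`).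
[cite: ApplegateEtAl2022, Lemma 3 (with Lemma 2 replaced by Hoffman's bound); Hoffman1952, Theorem §2] -/
theorem isSharpOn_bilinear (K : EuclideanSpace ℝ ιx →L[ℝ] EuclideanSpace ℝ ιy)
    (c : EuclideanSpace ℝ ιx) (b : EuclideanSpace ℝ ιy) {τ σ : ℝ} (hτ : 0 < τ) (hσ : 0 < σ)
    (hK : τ * σ * ‖K‖ ^ 2 < 1) (hZ : (saddleSet K Set.univ Set.univ c b).Nonempty) :
    ∃ α : ℝ, 0 < α ∧ ∀ S : Set (EuclideanSpace ℝ ιx × EuclideanSpace ℝ ιy),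
      IsSharpOn K Set.univ Set.univ c b τ σ S α := by
  classical
  obtain ⟨H, hH0, hH⟩ := hoffman (bilNormal (ιx := ιx) (ιy := ιy) K)
  have hPne : (polyhedron (bilNormal K) (bilRhs c b)).Nonempty := by
    rw [polyhedron_bil_eq]; exact hZ.image _
  set Zs := saddleSet K (Set.univ : Set (EuclideanSpace ℝ ιx)) (Set.univ : Set (EuclideanSpace ℝ ιy))
    c b with hZs
  set cU := cUp K τ σ with hcUdef
  set B := (Real.sqrt (Fintype.card ιx) + Real.sqrt (Fintype.card ιy)) * cU with hB
  have hcU : 0 ≤ cU := cUp_nonneg K τ σ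
  have hB0 : 0 ≤ B := by positivity
  have hD0 : 0 < cU * H * B + 1 := by positivity
  refine ⟨(cU * H * B + 1)⁻¹, inv_pos.mpr hD0, fun S => ?_⟩
  intro z _ r hr _
  have hρ0 := rho_nonneg_of_mem K c b hτ hσ hK (Set.mem_univ z.1) (Set.mem_univ z.2) hr
  set ρr := rho K Set.univ Set.univ c b τ σ r z with hρr
  obtain ⟨x₀, hx₀P, hx₀⟩ := hH (bilRhs c b) hPne (WithLp.toLp 2 z)
  have hx₀Z : WithLp.ofLp x₀ ∈ Zs := by
    rw [hZs, ← mem_polyhedron_bil_iff, WithLp.toLp_ofLp]; exact hx₀P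
  have hdist : infDistM K τ σ z Zs ≤ cU * (H * ∑ ρ, HoffmanErrorBound.residual (bilNormal K)
      (bilRhs c b) (WithLp.toLp 2 z) ρ) := by
    have h := infDistM_le_cUp_mul K hτ hσ z hx₀Z
    rw [WithLp.toLp_ofLp] at h
    exact h.trans (mul_le_mul_of_nonneg_left hx₀ hcU)
  have hV := bil_residual_sum_le K c b hτ hσ hK z hr
  have hmain : infDistM K τ σ z Zs ≤ (cU * H * B + 1) * ρr := by
    have h1 : infDistM K τ σ z Zs ≤ cU * H * (B * ρr) := by
      calc infDistM K τ σ z Zs ≤ cU * (H * ∑ ρ, HoffmanErrorBound.residual (bilNormal K)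
            (bilRhs c b) (WithLp.toLp 2 z) ρ) := hdist
        _ ≤ cU * (H * (B * ρr)) :=
            mul_le_mul_of_nonneg_left (mul_le_mul_of_nonneg_left hV hH0) hcU
        _ = cU * H * (B * ρr) := by ring
    nlinarith [mul_nonneg (mul_nonneg hcU hH0) hB0]
  rw [inv_mul_le_iff₀ hD0]
  exact hmain

omit [DecidableEq ιx] [DecidableEq ιy] in
/-- **Restarted PDHG converges linearly — globally — on unconstrained bilinear problems**
([ApplegateEtAl2022, Theorem 1 with Lemma 3]; the `O(κ log(1/ε))` statement of §5 for PDHG):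
with `α` from `isSharpOn_bilinear`, for every restart length `t` with `4/(αt) ≤ β` and EVERY start
`z₀`, `dist_M(z^{n,0}, Z*) ≤ βⁿ dist_M(z₀, Z*)`.
[cite: ApplegateEtAl2022, Theorem 1 with Lemma 3 (bilinear problems)] -/
theorem bilinear_restartedPDHG_linear (K : EuclideanSpace ℝ ιx →L[ℝ] EuclideanSpace ℝ ιy)
    (c : EuclideanSpace ℝ ιx) (b : EuclideanSpace ℝ ιy) {τ σ : ℝ} (hτ : 0 < τ) (hσ : 0 < σ)
    (hK : τ * σ * ‖K‖ ^ 2 < 1) {jA : EuclideanSpace ℝ ιx → EuclideanSpace ℝ ιx}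
    {jB : EuclideanSpace ℝ ιy → EuclideanSpace ℝ ιy}
    (hjA : IsResolventMap τ (shiftOp c (normalCone (Set.univ : Set (EuclideanSpace ℝ ιx)))) jA)
    (hjB : IsResolventMap σ (shiftOp b (normalCone (Set.univ : Set (EuclideanSpace ℝ ιy)))) jB)
    (hZ : (saddleSet K Set.univ Set.univ c b).Nonempty) {β : ℝ} (hβ0 : 0 ≤ β) (hβ1 : β < 1) :
    ∃ α : ℝ, 0 < α ∧ ∀ t : ℕ, t ≠ 0 → 4 / (α * t) ≤ β →
      ∀ z₀ : EuclideanSpace ℝ ιx × EuclideanSpace ℝ ιy, ∀ n : ℕ,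
        infDistM K τ σ ((avgPDHG K τ σ jA jB t)^[n] z₀) (saddleSet K Set.univ Set.univ c b) ≤
          β ^ n * infDistM K τ σ z₀ (saddleSet K Set.univ Set.univ c b) := by
  obtain ⟨α, hα, hsharp⟩ := isSharpOn_bilinear K c b hτ hσ hK hZ
  exact ⟨α, hα, fun t ht htstar z₀ n => infDistM_iterate_avgPDHG_le_pow K convex_univ convex_univ
    c b hτ hσ hK.le hjA hjB hZ ht hα hβ0 hβ1 htstar ⟨Set.mem_univ _, Set.mem_univ _⟩ (hsharp _) n⟩

/-! ### Adaptive restarts on LP ([ApplegateEtAl2022, Theorem 2 with Lemma 5 and Proposition 9]) -/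

omit [DecidableEq ιx] [DecidableEq ιy] in
/-- **One sharp ball for all restart sequences** ([ApplegateEtAl2022, Proposition 9 + Lemma 5] for
PDHG on LP): from a feasible start `z₀` (`x₀ ≥ 0`) of a solvable LP there are `α > 0` and a radius `R`
such that the LP saddle is `α`-sharp on the feasible `M`-ball `W_R(z₀)` AND every restart point of
restarted PDHG — for any restart lengths — lies in that ball (`R = 2‖z₀ − z*‖_M` for a saddle point
`z*`, `α` from `isSharpOn_lp`). This is the standing hypothesis "`z^{n,0} ∈ S`, sharp on `S`" of
Theorem 2, discharged for LP. [cite: ApplegateEtAl2022, Proposition 9 with Lemma 5 (LP: S = W_R(z^{0,0}))] -/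
theorem exists_isSharpOn_restart_ball (K : EuclideanSpace ℝ ιx →L[ℝ] EuclideanSpace ℝ ιy)
    (c : EuclideanSpace ℝ ιx) (b : EuclideanSpace ℝ ιy) {τ σ : ℝ} (hτ : 0 < τ) (hσ : 0 < σ)
    (hK : τ * σ * ‖K‖ ^ 2 < 1) {jA : EuclideanSpace ℝ ιx → EuclideanSpace ℝ ιx}
    {jB : EuclideanSpace ℝ ιy → EuclideanSpace ℝ ιy}
    (hjA : IsResolventMap τ (shiftOp c (normalCone (orthant ιx))) jA)
    (hjB : IsResolventMap σ (shiftOp b (normalCone (Set.univ : Set (EuclideanSpace ℝ ιy)))) jB)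
    (hZ : (saddleSet K (orthant ιx) Set.univ c b).Nonempty)
    {z₀ : EuclideanSpace ℝ ιx × EuclideanSpace ℝ ιy} (hz₀ : z₀.1 ∈ orthant ιx) :
    ∃ α R : ℝ, 0 < α ∧
      IsSharpOn K (orthant ιx) Set.univ c b τ σ (ballM K (orthant ιx) Set.univ τ σ z₀ R) α ∧
      ∀ (z : ℕ → EuclideanSpace ℝ ιx × EuclideanSpace ℝ ιy) (τs : ℕ → ℕ), (∀ n, τs n ≠ 0) →
        z 0 = z₀ → (∀ n, z (n + 1) = avgPDHG K τ σ jA jB (τs n) (z n)) →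
        ∀ n, z n ∈ ballM K (orthant ιx) Set.univ τ σ z₀ R := by
  obtain ⟨zs, hzs⟩ := hZ
  obtain ⟨α, hα, hsharp⟩ := isSharpOn_lp K c b hτ hσ hK ⟨zs, hzs⟩ z₀ (2 * normM K τ σ (z₀ - zs))
  refine ⟨α, 2 * normM K τ σ (z₀ - zs), hα, hsharp, fun z τs hτs h0 hz n => ?_⟩
  subst h0
  exact restart_mem_ballM K convex_orthant convex_univ hτ hσ hK.le hjA hjB hzs hτs hz
    ⟨hz₀, Set.mem_univ _⟩ n

omit [DecidableEq ιx] [DecidableEq ιy] in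
/-- **Adaptively restarted PDHG converges linearly on linear programs** ([ApplegateEtAl2022,
Theorem 2 (ii)] with Lemma 5 and Proposition 9): for the LP saddle on `x ≥ 0`, `y` free, with a
primal–dual solution, steps `τσ‖K‖² < 1`, a feasible start `z₀` and `β ≥ 0`, there is `α > 0` such that
EVERY restart sequence `z^{n+1,0} = z̄^{n,τ_n}` (`τ_n ≥ 1`) obeying the adaptive criterion
`ρ_{‖z^{n+2,0} − z^{n+1,0}‖}(z^{n+2,0}) ≤ β ρ_{‖z^{n+1,0} − z^{n,0}‖}(z^{n+1,0})` satisfies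
`dist_M(z^{n+1,0}, Z*) ≤ βⁿ (4/(ατ₀)) dist_M(z₀, Z*)`.
[cite: ApplegateEtAl2022, Theorem 2 (ii) with Lemma 5 and Proposition 9 (LP)] -/
theorem lp_adaptive_restartedPDHG_linear (K : EuclideanSpace ℝ ιx →L[ℝ] EuclideanSpace ℝ ιy)
    (c : EuclideanSpace ℝ ιx) (b : EuclideanSpace ℝ ιy) {τ σ : ℝ} (hτ : 0 < τ) (hσ : 0 < σ)
    (hK : τ * σ * ‖K‖ ^ 2 < 1) {jA : EuclideanSpace ℝ ιx → EuclideanSpace ℝ ιx}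
    {jB : EuclideanSpace ℝ ιy → EuclideanSpace ℝ ιy}
    (hjA : IsResolventMap τ (shiftOp c (normalCone (orthant ιx))) jA)
    (hjB : IsResolventMap σ (shiftOp b (normalCone (Set.univ : Set (EuclideanSpace ℝ ιy)))) jB)
    (hZ : (saddleSet K (orthant ιx) Set.univ c b).Nonempty) {β : ℝ} (hβ : 0 ≤ β)
    {z₀ : EuclideanSpace ℝ ιx × EuclideanSpace ℝ ιy} (hz₀ : z₀.1 ∈ orthant ιx) :
    ∃ α : ℝ, 0 < α ∧
      ∀ (z : ℕ → EuclideanSpace ℝ ιx × EuclideanSpace ℝ ιy) (τs : ℕ → ℕ), (∀ n, τs n ≠ 0) →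
        z 0 = z₀ → (∀ n, z (n + 1) = avgPDHG K τ σ jA jB (τs n) (z n)) →
        (∀ n, rho K (orthant ιx) Set.univ c b τ σ (normM K τ σ (z (n + 2) - z (n + 1))) (z (n + 2)) ≤
          β * rho K (orthant ιx) Set.univ c b τ σ (normM K τ σ (z (n + 1) - z n)) (z (n + 1))) →
        ∀ n, infDistM K τ σ (z (n + 1)) (saddleSet K (orthant ιx) Set.univ c b) ≤
          β ^ n * (4 / (α * τs 0)) * infDistM K τ σ z₀ (saddleSet K (orthant ιx) Set.univ c b) := by
  obtain ⟨α, R, hα, hsharp, hball⟩ := exists_isSharpOn_restart_ball K c b hτ hσ hK hjA hjB hZ hz₀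
  refine ⟨α, hα, fun z τs hτs h0 hz hcond n => ?_⟩
  have hzS := hball z τs hτs h0 hz
  subst h0
  exact infDistM_adaptive_avgPDHG_le K convex_orthant convex_univ c b hτ hσ hK.le hjA hjB hZ hα hβ
    hsharp hτs hz hzS hcond n

omit [DecidableEq ιx] [DecidableEq ιy] in
/-- **Adaptive restart lengths on LP are bounded** ([ApplegateEtAl2022, Theorem 2 (i)] with Lemma 5
and Proposition 9): with `α` as above, if each restart from `z^{n+1,0}` happens at the FIRST inner
length at which the adaptive criterion holds, then that length is `≤ t₁` for every `t₁ ≥ 1` with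
`4/(αt₁) ≤ β` (e.g. `t₁ = ⌈4/(αβ)⌉`). [cite: ApplegateEtAl2022, Theorem 2 (i) with Lemma 5 and Proposition 9 (LP)] -/
theorem lp_adaptive_length_le (K : EuclideanSpace ℝ ιx →L[ℝ] EuclideanSpace ℝ ιy)
    (c : EuclideanSpace ℝ ιx) (b : EuclideanSpace ℝ ιy) {τ σ : ℝ} (hτ : 0 < τ) (hσ : 0 < σ)
    (hK : τ * σ * ‖K‖ ^ 2 < 1) {jA : EuclideanSpace ℝ ιx → EuclideanSpace ℝ ιx}
    {jB : EuclideanSpace ℝ ιy → EuclideanSpace ℝ ιy}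
    (hjA : IsResolventMap τ (shiftOp c (normalCone (orthant ιx))) jA)
    (hjB : IsResolventMap σ (shiftOp b (normalCone (Set.univ : Set (EuclideanSpace ℝ ιy)))) jB)
    (hZ : (saddleSet K (orthant ιx) Set.univ c b).Nonempty) {β : ℝ}
    {z₀ : EuclideanSpace ℝ ιx × EuclideanSpace ℝ ιy} (hz₀ : z₀.1 ∈ orthant ιx) :
    ∃ α : ℝ, 0 < α ∧
      ∀ (z : ℕ → EuclideanSpace ℝ ιx × EuclideanSpace ℝ ιy) (τs : ℕ → ℕ), (∀ n, τs n ≠ 0) →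
        z 0 = z₀ → (∀ n, z (n + 1) = avgPDHG K τ σ jA jB (τs n) (z n)) →
        ∀ n : ℕ, ∀ t₁ : ℕ, t₁ ≠ 0 → 4 / (α * t₁) ≤ β →
          (∀ t : ℕ, t ≠ 0 → t < τs (n + 1) →
            ¬ rho K (orthant ιx) Set.univ c b τ σ
                (normM K τ σ (avgPDHG K τ σ jA jB t (z (n + 1)) - z (n + 1)))
                (avgPDHG K τ σ jA jB t (z (n + 1))) ≤
              β * rho K (orthant ιx) Set.univ c b τ σ (normM K τ σ (z (n + 1) - z n)) (z (n + 1))) →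
          τs (n + 1) ≤ t₁ := by
  obtain ⟨α, R, hα, hsharp, hball⟩ := exists_isSharpOn_restart_ball K c b hτ hσ hK hjA hjB hZ hz₀
  refine ⟨α, hα, fun z τs hτs h0 hz n t₁ ht₁ htstar hfirst => ?_⟩
  have hzS := hball z τs hτs h0 hz
  exact adaptive_length_avgPDHG_le K convex_orthant convex_univ c b hτ hσ hK.le hjA hjB hZ hα hsharp
    (hτs n) (hz n) (hzS n) (hzS (n + 1)) hfirst ht₁ htstar

end Literature.Analysis.Convex.LinearProgramSharpness
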